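import Literature.AlgebraicGeometry.HodgeTheory.AbelianLowDimensionWeilReduction
import Literature.AlgebraicGeometry.HodgeTheory.HardLefschetzNFold
import Literature.AlgebraicGeometry.HodgeTheory.HardLefschetzNFoldHolds
import Literature.AlgebraicGeometry.HodgeTheory.LefschetzOneOneOfGlobalSections
import Literature.AlgebraicGeometry.HodgeTheory.LefschetzOneOneOfKodairaSerre
import Literature.AlgebraicGeometry.HodgeTheory.LefschetzOneOneOfGAGA
import Literature.AlgebraicGeometry.HodgeTheory.KodairaSerreSectionsAllDim
import Literature.AlgebraicGeometry.HodgeTheory.CorrespondenceComposition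
import Literature.AlgebraicGeometry.HodgeTheory.AbelianVarietyPullbackAlgebraicClasses
import Literature.AlgebraicGeometry.Motives.AbelianVarietyProjectiveChart
import Literature.AlgebraicGeometry.Motives.AbelianVarietyMulN
import Literature.AlgebraicGeometry.HodgeTheory.AbelianLowDimensionCodimTwoHodgeClasses
import HarnessLib

/-!
# The Moonen–Zarhin reduction `dim ≤ 5 ⇐ Weil classes of fourfolds`: the printed combination, proved down to its codimension-`2` inputs

Family `hodge`, layer `Literature/AlgebraicGeometry/HodgeTheory`. Sibling PROOF FILE of
`AbelianLowDimensionWeilReduction`, which states the named fact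
`MoonenZarhin1999_hodgeClasses_abelian_dim_le_five_of_weilClassesFourfolds`
(`Markman2025_weilClasses_algebraic_abelianFourfold → Markman2025_hodgeClasses_algebraic_abelian_dim_le_five`:
if the rational `(2,2)`-classes of the Weil planes `weilClassesOf B φ 2 d` of all complex abelian
fourfolds are algebraic, then every rational `(p,p)`-class on every complex abelian variety of
dimension `≤ 5` is algebraic). That fact is NOT discharged here and this file introduces NO new
named fact (D-0026): it PROVES the combination step of the printed argument — E. Markman,
arXiv:2509.23403 §1.1, the paragraph before Cor. 1.3: "The Hodge ring of abelian fourfolds is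
generated by divisor classes and Weil classes … by work of Moonen and Zarhin … combined with a result
of Ramón Marí in the case of products of abelian surfaces. The Hodge ring for simple abelian
varieties of prime dimension is generated by divisor classes, by a result of Tankeev. If `X` is a
non-simple abelian variety of dimension `5`, then the Hodge ring of `X` is generated by divisor
classes and pull backs of Weil classes from quotient abelian fourfolds … Combining these results with
Theorem 1.2 we get: Corollary 1.3" — on the real carriers of the layer, leaving as explicit
HYPOTHESES OF THEOREMS exactly the published inputs the tree does not prove:

* (L11) Lefschetz's theorem on `(1,1)`-classes — the tree's named fact `lefschetzOneOne_rational`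
  (`LefschetzOneOne`; only its instances on abelian varieties of dimension `≤ 5` are used);
* (HL) hard Lefschetz for the hyperplane class — the tree's named fact `nonempty_hardLefschetzNFold`
  (`HardLefschetzNFold`; only abelian varieties of dimension `≤ 5` are used), which the tree
  DISCHARGES (`nonempty_hardLefschetzNFold_holds`, file `HardLefschetzNFoldHolds`) — fed in at the
  end of this file, so that the residue is (L11) + (MZ4) + (MZ5);
* (MZ4) Moonen–Zarhin in dimension `4`, CODIMENSION-`2` PART: on a complex abelian fourfold `X`,
  `B²(X) ⊆ D²(X) + Σ_k W_k` — B. Moonen, Yu. Zarhin, Math. Ann. 315 (1999) Thm. 0.1 (read: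
  arXiv:math/9901113, Introduction): in cases (a), (b) "the Hodge ring `B•(X)` is generated by the
  subalgebra `D•(X)` of divisor classes together with the space of Weil classes `W_k ⊂ B²(X)`", in
  case (c) "together with the spaces of Weil classes `W_k ⊂ B²(X)`, where `k` runs through the set of
  imaginary quadratic fields contained in `D`", in case (d) and "(4) … not in one of the cases (a),
  (b), (c) or (d)" `B•(X) = D•(X)` (simple fourfolds: Moonen–Zarhin, Duke Math. J. 77 (1995) = van
  Geemen LNM 1594 Thm. 4.12; products of abelian surfaces: Ramón Marí, Collect. Math. 59 (2008)
  Prop. 2.18, "we prove only the cases not included in Moonen and Zarhin");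
* (MZ5) Moonen–Zarhin in dimension `5`, CODIMENSION-`2` PART: on a complex abelian fivefold `X`,
  `B²(X) ⊆ D²(X) + Σ_α α^* W_k(X')` over surjective homomorphisms `α : X → X'` onto abelian
  fourfolds — ibid. Thm. 0.2: (1) case (e) "the Hodge ring `B•(X)` is generated by the subalgebra
  `D•(X)` of divisor classes together with the subspaces `W_{k,α}`" (`W_{k,α}` = image of
  `W_k ⊂ B²(X₁ × X₂)` under "the map `B²(X₁ × X₂) → B²(X)` induced by a surjective homomorphism
  `α : X → X₁ × X₂`"), (2) case (f) "`B•(X)` is generated by the divisor classes `D•(X)` together with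
  the pull-backs of the Weil classes in `W_k ⊂ B²(X₁ × X₂)`", (3) case (g) `B•(X) = D•(X)`, (4)
  otherwise "`B•(Xⁿ)` is generated by the images of the Hodge rings `B•(Y_j^{m_j})`" of the
  isotypic factors (a simple factor `Y` of dimension `4` contributes `D•(Y)` and its `W_k`, case
  (MZ4); "if `X` has no simple factor of dimension 4 then … `B•(Xⁿ) = D•(Xⁿ)`", which includes simple
  fivefolds: Tankeev–Ribet, van Geemen Thm. 4.6).

## The argument on the carriers, and the one deviation from print

Write `n = A.dim ≤ 5` and let `c ∈ H²ᵖ(A(ℂ); ℂ)` be rational of type `(p, p)`.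
* `2p > n`: by (HL), `c = L^{2p-n} c'` with `c'` rational of type `(n-p, n-p)` and `L^{2p-n}`
  preserves algebraicity (`mem_algebraicClasses_of_lt_of_nonempty`, file `HardLefschetzNFold`), so
  it suffices to treat `2p ≤ n`, i.e. `p ≤ 2`. THIS IS THE DEVIATION: print generates the whole
  Hodge RING `B•` (all degrees) and concludes with "intersections and pull-backs of algebraic cycles
  are algebraic"; the tree proves the cup product with supports only against DIVISOR classes on an
  abelian variety (`AbelianVariety.cupProduct_mem_algebraicClasses_one`, Kleiman moving by
  translations) — enough for `D•` and `D• · W`, not for `W · W'` in `H⁸` of a fivefold — so the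
  degrees above the middle are routed through hard Lefschetz instead (the standard remark,
  Kerr–Pearlstein 2011 §3.1), and only the `B²`-parts (MZ4), (MZ5) of Thms. 0.1–0.2 are consumed.
* `p = 0`: `N⁰ H⁰ = H⁰` (`hodgeConjectureFor_codim_zero`). `p = 1`: (L11).
* `p = 2`, `n = 4`: by (MZ4) `c ∈ (D² ⊗ ℂ) + span_ℂ {rational (2,2) Weil classes}`; the first summand
  is algebraic by (L11) and `AbelianVariety.cupProduct_mem_algebraicClasses_one`
  (`AbelianVariety.divisorClassesSpan_le_algebraicClasses`), the second by the ANTECEDENT of the fact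
  (`Markman2025_weilClasses_algebraic_abelianFourfold`) — `mem_algebraicClasses_two_of_dim_eq_four`.
* `p = 2`, `n = 5`: by (MZ5) `c ∈ (D² ⊗ ℂ) + span_ℂ {α^* w}`; `w` is algebraic on the fourfold by the
  antecedent and flat pull-back preserves the support filtration (`map_mem_supportedClasses_of_flat_left`,
  PROVED in `CorrespondenceComposition`; Hartshorne III Prop. 9.5) — `mem_algebraicClasses_two_of_dim_eq_five`.

Assembly: `MoonenZarhin1999_hodgeClasses_abelian_dim_le_five_of_weilClassesFourfolds_of'` (inputs
restricted to abelian varieties of dimension `≤ 5`) and `…_of` (fed with the two named facts as they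
stand); and, granted (L11) + (HL) alone, the fact is EQUIVALENT to its codimension-`2` slice on
abelian `4`- and `5`-folds (`…_iff_codim_two`), which is therefore exactly where Moonen–Zarhin's
classification enters. With (HL) DISCHARGED by the tree (`nonempty_hardLefschetzNFold_holds`):
`…_of_lefschetzOneOne` ((L11) → (MZ4) → (MZ5) → fact), `…_iff_codim_two_of_lefschetzOneOne`, and
`…_of_globalSections` (the fact from the Kodaira–Serre existence of sections — the only input the
tree's proof of (L11) still takes, `lefschetzOneOne_rational_of_globalSections` — plus (MZ4), (MZ5)).
Last section: (MZ4) and (MZ5⁺) merged into ONE hypothesis (MZ) of the same shape for `A.dim = 4 ∨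
A.dim = 5` (`…_of_codim_two_pullback`, `codim_two_pullback_of_codim_two`), and (L11) traced to its one
unproved named leaf in the tree, GAGA for line bundles (`serreGAGA_lineCocycle_iso_cartierDivisorCocycle`
⟹ `kodairaSerre_exists_globalSection_algebraicTwist` ⟹ `lefschetzOneOne_rational`, files
`KodairaSerreSectionsProofs`, `LefschetzOneOneOfKodairaSerre`, `LefschetzOneOneOfGAGA`):
`…_of_kodairaSerre`, `…_of_serreGAGA` (`serreGAGA… → (MZ) → fact`), `…_of_serreGAGA'`.

## Faithfulness of (MZ4), (MZ5) as Lean hypotheses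

* `D² ⊗ ℂ = divisorClassesSpan A.X A.dim 2` (barrier file `ExceptionalHodgeClasses`): the `ℂ`-span of
  cup products of two rational `(1,1)`-classes — Moonen–Zarhin (1.4): `D•(X)` is "the `ℚ`-subalgebra
  generated by the divisor classes", the divisor classes being "the Hodge classes in `H²(X, ℚ)`".
* `W_k ⊗ ℂ`: the `ℂ`-span of the RATIONAL `(2,2)`-classes lying in a Weil plane `weilClassesOf A φ 2 d`,
  `φ ≫ φ = -(d • 𝟙 A)`, `d ≥ 1` (module docstring of `WeilClasses`: `E₊ ⊔ E₋ = W_k ⊗ ℂ`, `k = ℚ(φ)`;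
  every imaginary quadratic `k ⊂ End⁰(A)` is `ℚ(φ)` for such a `φ ∈ End(A)`, docstring of the fact);
  by (1.9) "either `W_K` consists entirely of Hodge classes or `0 ∈ W_K` is the only Hodge class in
  `W_K`", so the generators `W_k ⊂ B²` of print are rational `(2,2)`-classes of these planes, and
  taking ALL `(φ, d)` only enlarges the generating set: (MZ4) as stated is implied by Thm. 0.1.
* (MZ5) quantifies over `α : A ⟶ B`, `B.dim = 4`, SURJECTIVE (as printed) and FLAT: a surjective
  homomorphism of abelian varieties is automatically flat (its fibres are translates of the kernel,
  all of dimension `dim A - dim B`, between regular schemes: EGA IV₂ 6.1.5 "miracle flatness";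
  Mumford §4), a theorem the tree does not yet have, so flatness is recorded in the generator
  condition — the generating set is literally that of print, and (MZ5) as stated is implied by
  Thm. 0.2 (with Thm. 0.1 for a simple fourfold factor).
* (MZ5⁺), the form consumed by the primed assembly at the end of the file, ENLARGES the generating
  set to the pull-backs `g^* w` along ALL `ℂ`-morphisms `g : A ⟶ B` to abelian fourfolds (no
  surjectivity, no flatness): a weaker hypothesis, a fortiori implied by Thm. 0.2, and usable
  because the tree now proves that pull-back along ANY morphism from a smooth projective variety
  to an abelian variety preserves `Nᵖ H²ᵖ` (`map_mem_algebraicClasses_of_abelianVariety`, file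
  `AbelianVarietyPullbackAlgebraicClasses`: Kleiman's general translate, Fulton App. B.9.2 (a) and
  Cor. 19.2 (b)) — so the flatness proviso above is no longer part of the residue.
* Both are hypotheses of theorems, never named facts; nothing stronger than print is assumed, and
  the conclusion is the fact as vendored, unchanged.

## What is NOT here

The discharge of (L11) (reduced in the tree to the Kodaira–Serre existence of sections,
`lefschetzOneOne_rational_of_globalSections`, and that to the one named fact GAGA for line bundles,
`serreGAGA_lineCocycle_iso_cartierDivisorCocycle` — Serre 1956 n° 20 Prop. 18 — files
`KodairaSerreSectionsProofs`, `LefschetzOneOneOfGAGA`),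
and of (MZ4)/(MZ5)/(MZ) themselves — Moonen–Zarhin's determination of
the Hodge groups of all complex abelian varieties of dimension `≤ 5` (Mumford–Tate groups, Deligne's
length-one/minuscule constraints, the Hazama–Murty criterion, Goursat-type product lemmas, CM
surfaces; Math. Ann. 315 §§1–5), which needs `H•(A, ℚ) = ⋀• H¹` as Hodge structures with its
`End⁰(A)`-action on the real carriers, not in the tree (module docstring of `WeilClasses`).

## References

* [MoonenZarhin1999LowDim] B. Moonen, Yu. Zarhin, Hodge classes on abelian varieties of low
  dimension, Math. Ann. 315 (1999) 711–733, Thm. 0.1, Thm. 0.2, (1.4), (1.9) (arXiv:math/9901113).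
* [MoonenZarhin1995Duke] B. Moonen, Yu. Zarhin, Hodge classes and Tate classes on simple abelian
  fourfolds, Duke Math. J. 77 (1995) 553–581.
* [RamonMari2008] J. J. Ramón Marí, On the Hodge conjecture for products of certain surfaces,
  Collect. Math. 59 (2008), Prop. 2.18 (arXiv:math/0505357).
* [Markman2025SurveySecant] E. Markman, Secant sheaves and Weil classes on abelian varieties,
  arXiv:2509.23403, §1.1 and Cor. 1.3.
* [vanGeemen1994HodgeAV] B. van Geemen, LNM 1594 (1994), §2.4, Thm. 4.6, Thm. 4.12, 4.9.
* [VoisinHodgeI2002] C. Voisin, Hodge Theory and Complex Algebraic Geometry I, Thm. 6.25, Rem. 6.27,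
  §7.1.2, Thm. 11.30. [VoisinHodgeII2003] II, §9.2.4 Prop. 9.20.
* [SerreGAGA1956] J.-P. Serre, Géométrie algébrique et géométrie analytique, Ann. Inst. Fourier 6
  (1956), n° 20 Prop. 18.
* [KerrPearlstein2011] M. Kerr, G. Pearlstein, MSRI Publ. 58 (2011), §3.1.
* [Hartshorne1977] R. Hartshorne, Algebraic Geometry, III Prop. 9.5.
* [Fulton1998] W. Fulton, Intersection Theory, 2nd ed. (1998), §19.2 Cor. 19.2 (b), App. B.9.2 (a).
-/

noncomputable section

open CategoryTheory AlgebraicGeometry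

namespace Literature.AlgebraicGeometry.HodgeTheory

open Literature.AlgebraicTopology.SingularHomology
open Literature.AlgebraicGeometry.Motives
open Literature.Barriers.HodgeConjecture

section HodgeTheory

/-! ### `D• ⊗ ℂ` is algebraic on an abelian variety, granted Lefschetz `(1,1)` on it -/

/-- **Divisor monomials are algebraic on a complex abelian variety, granted Lefschetz `(1,1)` on
it**: if every rational `(1,1)`-class of `H²(A(ℂ); ℂ)` (Hodge types read in dimension `N`) lies in
`N¹ H²`, then every `p`-fold cup product of such classes lies in `Nᵖ H²ᵖ` — induction on `p`, the
product with a divisor class staying algebraic by the tree's theorem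
`AbelianVariety.cupProduct_mem_algebraicClasses_one` (move the divisor by a general translate; no
Chow moving lemma). Van Geemen §2.4: "`Dᵖ` is spanned by `[D₁] ∪ [D₂] ∪ … ∪ [D_p]`, `Dᵢ ∈ Z¹(X)` …
Therefore we have the inclusions `Dᵖ ⊂ Im(Ψ) ⊂ Bᵖ`." [cite: vanGeemen1994HodgeAV, §2.4]
[cite: VoisinHodgeII2003, §9.2.4 Prop. 9.20] -/
theorem AbelianVariety.divisorMonomials_subset_algebraicClasses (A : AbelianVariety ℂ) {N : ℕ}
    (h11 : ∀ b : complexBetti A.X (2 * 1), IsRationalClass b → IsOfHodgeType N A.X (2 * 1) 1 1 b →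
      b ∈ algebraicClasses A.X 1) :
    ∀ p : ℕ, divisorMonomials A.X N p ⊆ (algebraicClasses A.X p : Set (complexBetti A.X (2 * p)))
  | 0 => fun c _ ↦ hodgeConjectureFor_codim_zero c
  | p + 1 => by
    rintro c hc
    obtain ⟨a, ha, b, hb, hb', rfl⟩ := mem_divisorMonomials_succ.1 hc
    exact AbelianVariety.cupProduct_mem_algebraicClasses_one A
      (AbelianVariety.divisorMonomials_subset_algebraicClasses A h11 p ha) (h11 b hb hb')

/-- **`Dᵖ ⊗ ℂ ⊆ Nᵖ H²ᵖ` on a complex abelian variety, granted Lefschetz `(1,1)` on it** (the span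
form of `AbelianVariety.divisorMonomials_subset_algebraicClasses`): "if `Dᵖ = Bᵖ`, then the Hodge
`(p, p)`-conjecture is true for `X`" (van Geemen §2.4) is this inclusion.
[cite: vanGeemen1994HodgeAV, §2.4] -/
theorem AbelianVariety.divisorClassesSpan_le_algebraicClasses (A : AbelianVariety ℂ) {N : ℕ}
    (h11 : ∀ b : complexBetti A.X (2 * 1), IsRationalClass b → IsOfHodgeType N A.X (2 * 1) 1 1 b →
      b ∈ algebraicClasses A.X 1) (p : ℕ) :
    divisorClassesSpan A.X N p ≤ algebraicClasses A.X p :=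
  Submodule.span_le.2 (AbelianVariety.divisorMonomials_subset_algebraicClasses A h11 p)

/-! ### Codimension `2` on abelian fourfolds: `B² ⊆ D² + Σ W_k` (MZ4) and the antecedent -/

/-- **The codimension-`2` step on an abelian fourfold.** Granted the antecedent of the fact (the
rational `(2,2)`-classes of every Weil plane of every abelian fourfold are algebraic,
`Markman2025_weilClasses_algebraic_abelianFourfold`) and Lefschetz `(1,1)` on `A`, every class of
`H⁴(A(ℂ); ℂ)` lying in `(D² ⊗ ℂ) + span_ℂ {rational (2,2) Weil classes of (A, φ, d), φ ≫ φ = -d, d ≥ 1}`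
is algebraic — the right-hand side being where Moonen–Zarhin's Thm. 0.1 puts every Hodge class of
`B²(X)` of an abelian fourfold ("generated by the subalgebra `D•(X)` of divisor classes together with
the space(s) of Weil classes `W_k ⊂ B²(X)`"; `W_k ⊗ ℂ = E₊ ⊔ E₋ = weilClassesOf`, and by (1.9) the Weil
classes used as generators are Hodge, i.e. rational of type `(2,2)`). The divisor part is
`AbelianVariety.divisorClassesSpan_le_algebraicClasses`; the Weil part is the antecedent verbatim.
[cite: MoonenZarhin1999LowDim, Thm. 0.1 and (1.9)] [cite: Markman2025SurveySecant, §1.1 (before Cor. 1.3)]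
[cite: vanGeemen1994HodgeAV, 4.9 and Thm. 4.12] -/
theorem mem_algebraicClasses_two_of_dim_eq_four (hW : Markman2025_weilClasses_algebraic_abelianFourfold)
    (A : AbelianVariety ℂ) (hA : A.dim = 4)
    (h11 : ∀ b : complexBetti A.X (2 * 1), IsRationalClass b → IsOfHodgeType A.dim A.X (2 * 1) 1 1 b →
      b ∈ algebraicClasses A.X 1)
    {c : complexBetti A.X (2 * 2)}
    (hc : c ∈ divisorClassesSpan A.X A.dim 2 ⊔
      Submodule.span ℂ {w : complexBetti A.X (2 * 2) | ∃ (d : ℕ) (φ : A ⟶ A), 0 < d ∧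
        φ ≫ φ = -(d • 𝟙 A) ∧ IsRationalClass w ∧ IsOfHodgeType A.dim A.X (2 * 2) 2 2 w ∧
        w ∈ weilClassesOf A φ 2 d}) :
    c ∈ algebraicClasses A.X 2 := by
  have hX : IsSmoothProjective A.dim A.X := AbelianVariety.isSmoothProjective_holds
  have hA' : A.dim = 2 * 2 := hA
  refine (sup_le (AbelianVariety.divisorClassesSpan_le_algebraicClasses A h11 2)
    (Submodule.span_le.2 ?_)) hc
  rintro w ⟨d, φ, hd, hφ, hw, hw22, hwW⟩
  rw [hA'] at hw22
  exact hW d hd A φ hA' (by rw [← hA']; exact hX) hφ w hw hw22 hwW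

/-! ### Codimension `2` on abelian fivefolds: `B² ⊆ D² + Σ α^* W_k` (MZ5), the antecedent, and flat pull-back -/

/-- **The codimension-`2` step on an abelian fivefold.** Granted the antecedent of the fact and
Lefschetz `(1,1)` on `A`, every class of `H⁴(A(ℂ); ℂ)` lying in
`(D² ⊗ ℂ) + span_ℂ {α^* w : α : A ⟶ B a flat surjective homomorphism onto an abelian FOURFOLD B, w a rational (2,2) Weil class of (B, φ, d)}`
is algebraic — the right-hand side being where Moonen–Zarhin's Thm. 0.2 puts every Hodge class of
`B²(X)` of an abelian fivefold ("generated by the subalgebra `D•(X)` of divisor classes together with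
the subspaces `W_{k,α}`", the images of `W_k ⊂ B²(X₁ × X₂)` "induced by a surjective homomorphism
`α : X → X₁ × X₂`"; resp. "the pull-backs of the Weil classes"; resp. the images of the Hodge rings
of the isotypic factors). The pulled-back class `w` is algebraic on `B` by the antecedent, and flat
pull-back preserves `N² H⁴` (`map_mem_supportedClasses_of_flat_left`: codimension does not drop
along a flat morphism, Hartshorne III Prop. 9.5); flatness of a surjective homomorphism of abelian
varieties is automatic in print (miracle flatness) and is recorded in the hypothesis only because
the tree lacks it. [cite: MoonenZarhin1999LowDim, Thm. 0.2 and (1.9)]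
[cite: Markman2025SurveySecant, §1.1 (before Cor. 1.3)] [cite: Hartshorne1977, III Prop. 9.5] -/
theorem mem_algebraicClasses_two_of_dim_eq_five (hW : Markman2025_weilClasses_algebraic_abelianFourfold)
    (A : AbelianVariety ℂ)
    (h11 : ∀ b : complexBetti A.X (2 * 1), IsRationalClass b → IsOfHodgeType A.dim A.X (2 * 1) 1 1 b →
      b ∈ algebraicClasses A.X 1)
    {c : complexBetti A.X (2 * 2)}
    (hc : c ∈ divisorClassesSpan A.X A.dim 2 ⊔
      Submodule.span ℂ {w' : complexBetti A.X (2 * 2) |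
        ∃ (B : AbelianVariety ℂ) (α : A ⟶ B) (d : ℕ) (φ : B ⟶ B) (w : complexBetti B.X (2 * 2)),
          B.dim = 4 ∧ Surjective (AbelianVariety.Hom.toSchemeHom α) ∧
          Flat (AbelianVariety.Hom.toSchemeHom α) ∧ 0 < d ∧ φ ≫ φ = -(d • 𝟙 B) ∧
          IsRationalClass w ∧ IsOfHodgeType B.dim B.X (2 * 2) 2 2 w ∧ w ∈ weilClassesOf B φ 2 d ∧
          w' = complexBetti.map α.hom.hom.hom (2 * 2) w}) :
    c ∈ algebraicClasses A.X 2 := by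
  refine (sup_le (AbelianVariety.divisorClassesSpan_le_algebraicClasses A h11 2)
    (Submodule.span_le.2 ?_)) hc
  rintro w' ⟨B, α, d, φ, w, hB, -, hflat, hd, hφ, hw, hw22, hwW, rfl⟩
  have hXB : IsSmoothProjective B.dim B.X := AbelianVariety.isSmoothProjective_holds
  have hB' : B.dim = 2 * 2 := hB
  rw [hB'] at hw22
  have hwalg : w ∈ algebraicClasses B.X 2 :=
    hW d hd B φ hB' (by rw [← hB']; exact hXB) hφ w hw hw22 hwW
  haveI : Flat (AbelianVariety.Hom.toSchemeHom α) := hflat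
  exact map_mem_supportedClasses_of_flat_left α.hom.hom.hom hwalg

/-! ### Assembly: the fact from (L11), (HL), (MZ4), (MZ5) -/

/-- **The Moonen–Zarhin reduction from its printed inputs, all restricted to abelian varieties of
dimension `≤ 5`.** If (L11) every rational `(1,1)`-class on a complex abelian variety of dimension
`≤ 5` is algebraic (Lefschetz), (HL) every such variety carries the hard Lefschetz datum of an ample
class (`nonempty_hardLefschetzNFold A.dim A.X`), (MZ4) on every abelian fourfold every rational
`(2,2)`-class lies in `(D² ⊗ ℂ) + span_ℂ {rational (2,2) Weil classes}` (Moonen–Zarhin 1999 Thm. 0.1,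
with Moonen–Zarhin 1995 and Ramón Marí 2008 Prop. 2.18), and (MZ5) on every abelian fivefold every
rational `(2,2)`-class lies in `(D² ⊗ ℂ) + span_ℂ {flat surjective pull-backs of such Weil classes
from abelian fourfolds}` (ibid. Thm. 0.2, with Tankeev for simple fivefolds), THEN the algebraicity
of the Weil classes of abelian fourfolds implies that of every rational `(p,p)`-class on every
complex abelian variety of dimension `≤ 5` — the fact
`MoonenZarhin1999_hodgeClasses_abelian_dim_le_five_of_weilClassesFourfolds`. Proof: `2p > dim` is
reduced to `2(dim - p) < dim` by hard Lefschetz (`mem_algebraicClasses_of_lt_of_nonempty`); for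
`2p ≤ dim ≤ 5`, `p = 0` is `hodgeConjectureFor_codim_zero`, `p = 1` is (L11), and `p = 2` forces
`dim ∈ {4, 5}`: `mem_algebraicClasses_two_of_dim_eq_four` / `…_of_dim_eq_five`. (Print generates
the whole Hodge ring and uses that intersections of algebraic cycles are algebraic; routing the
degrees above the middle through hard Lefschetz instead consumes only the codimension-`2` parts of
Thms. 0.1–0.2 — see the module docstring.) [cite: MoonenZarhin1999LowDim, Thm. 0.1 and Thm. 0.2]
[cite: Markman2025SurveySecant, §1.1 and proof of Cor. 1.3] [cite: RamonMari2008, Prop. 2.18]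
[cite: MoonenZarhin1995Duke, main theorem] [cite: VoisinHodgeI2002, Thm. 6.25 and Thm. 11.30]
[cite: KerrPearlstein2011, §3.1] -/
theorem MoonenZarhin1999_hodgeClasses_abelian_dim_le_five_of_weilClassesFourfolds_of'
    (h1 : ∀ A : AbelianVariety ℂ, A.dim ≤ 5 → ∀ b : complexBetti A.X (2 * 1), IsRationalClass b →
      IsOfHodgeType A.dim A.X (2 * 1) 1 1 b → b ∈ algebraicClasses A.X 1)
    (hL : ∀ A : AbelianVariety ℂ, A.dim ≤ 5 → nonempty_hardLefschetzNFold A.dim A.X)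
    (hMZ4 : ∀ A : AbelianVariety ℂ, A.dim = 4 →
      ∀ c : complexBetti A.X (2 * 2), IsRationalClass c → IsOfHodgeType A.dim A.X (2 * 2) 2 2 c →
        c ∈ divisorClassesSpan A.X A.dim 2 ⊔
          Submodule.span ℂ {w : complexBetti A.X (2 * 2) | ∃ (d : ℕ) (φ : A ⟶ A), 0 < d ∧
            φ ≫ φ = -(d • 𝟙 A) ∧ IsRationalClass w ∧ IsOfHodgeType A.dim A.X (2 * 2) 2 2 w ∧
            w ∈ weilClassesOf A φ 2 d})
    (hMZ5 : ∀ A : AbelianVariety ℂ, A.dim = 5 →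
      ∀ c : complexBetti A.X (2 * 2), IsRationalClass c → IsOfHodgeType A.dim A.X (2 * 2) 2 2 c →
        c ∈ divisorClassesSpan A.X A.dim 2 ⊔
          Submodule.span ℂ {w' : complexBetti A.X (2 * 2) |
            ∃ (B : AbelianVariety ℂ) (α : A ⟶ B) (d : ℕ) (φ : B ⟶ B) (w : complexBetti B.X (2 * 2)),
              B.dim = 4 ∧ Surjective (AbelianVariety.Hom.toSchemeHom α) ∧
              Flat (AbelianVariety.Hom.toSchemeHom α) ∧ 0 < d ∧ φ ≫ φ = -(d • 𝟙 B) ∧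
              IsRationalClass w ∧ IsOfHodgeType B.dim B.X (2 * 2) 2 2 w ∧
              w ∈ weilClassesOf B φ 2 d ∧ w' = complexBetti.map α.hom.hom.hom (2 * 2) w}) :
    MoonenZarhin1999_hodgeClasses_abelian_dim_le_five_of_weilClassesFourfolds := by
  intro hW A hd hX p c hc hpp
  -- the half `2q ≤ dim A` (so `q ≤ 2`): codimension zero, Lefschetz `(1,1)`, and (MZ4)/(MZ5)
  have low : ∀ (q : ℕ) (c : complexBetti A.X (2 * q)), 2 * q ≤ A.dim → IsRationalClass c →
      IsOfHodgeType A.dim A.X (2 * q) q q c → c ∈ algebraicClasses A.X q := by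
    intro q c hq hc hqq
    have hq2 : q ≤ 2 := by omega
    interval_cases q
    · exact hodgeConjectureFor_codim_zero c
    · exact h1 A hd c hc hqq
    · obtain h4 | h5 : A.dim = 4 ∨ A.dim = 5 := by omega
      · exact mem_algebraicClasses_two_of_dim_eq_four hW A h4 (h1 A hd) (hMZ4 A h4 c hc hqq)
      · exact mem_algebraicClasses_two_of_dim_eq_five hW A (h1 A hd) (hMZ5 A h5 c hc hqq)
  -- the half `2p > dim A` comes from the other one by hard Lefschetz
  rcases Nat.lt_or_ge A.dim (2 * p) with hlt | hge
  · exact mem_algebraicClasses_of_lt_of_nonempty (hL A hd) hX hlt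
      (fun c' hc' hpp' ↦ low (A.dim - p) c' (by omega) hc' hpp') c hc hpp
  · exact low p c hge hc hpp

/-- **The Moonen–Zarhin reduction from the tree's two named facts and the codimension-`2` parts of
Moonen–Zarhin's theorems.** With (L11) = `lefschetzOneOne_rational` and (HL) =
`nonempty_hardLefschetzNFold` (for every smooth projective variety, as the facts stand; abelian
varieties are smooth projective, `AbelianVariety.isSmoothProjective_holds`) and the hypotheses (MZ4),
(MZ5) of `…_of'`, the fact `MoonenZarhin1999_hodgeClasses_abelian_dim_le_five_of_weilClassesFourfolds`
holds. Discharging it outright therefore costs exactly: GAGA for line bundles (to which the tree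
reduces (L11), `LefschetzOneOneOfGAGA`), hard Lefschetz, and Moonen–Zarhin's classification of the
Hodge classes of codimension `2` on abelian `4`- and `5`-folds. [cite: MoonenZarhin1999LowDim, Thm. 0.1 and Thm. 0.2]
[cite: Markman2025SurveySecant, §1.1 and proof of Cor. 1.3] [cite: VoisinHodgeI2002, Thm. 6.25 and Thm. 11.30] -/
theorem MoonenZarhin1999_hodgeClasses_abelian_dim_le_five_of_weilClassesFourfolds_of
    (h1 : lefschetzOneOne_rational)
    (hL : ∀ (n : ℕ) (X : SchemeOver ℂ), nonempty_hardLefschetzNFold n X)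
    (hMZ4 : ∀ A : AbelianVariety ℂ, A.dim = 4 →
      ∀ c : complexBetti A.X (2 * 2), IsRationalClass c → IsOfHodgeType A.dim A.X (2 * 2) 2 2 c →
        c ∈ divisorClassesSpan A.X A.dim 2 ⊔
          Submodule.span ℂ {w : complexBetti A.X (2 * 2) | ∃ (d : ℕ) (φ : A ⟶ A), 0 < d ∧
            φ ≫ φ = -(d • 𝟙 A) ∧ IsRationalClass w ∧ IsOfHodgeType A.dim A.X (2 * 2) 2 2 w ∧
            w ∈ weilClassesOf A φ 2 d})
    (hMZ5 : ∀ A : AbelianVariety ℂ, A.dim = 5 →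
      ∀ c : complexBetti A.X (2 * 2), IsRationalClass c → IsOfHodgeType A.dim A.X (2 * 2) 2 2 c →
        c ∈ divisorClassesSpan A.X A.dim 2 ⊔
          Submodule.span ℂ {w' : complexBetti A.X (2 * 2) |
            ∃ (B : AbelianVariety ℂ) (α : A ⟶ B) (d : ℕ) (φ : B ⟶ B) (w : complexBetti B.X (2 * 2)),
              B.dim = 4 ∧ Surjective (AbelianVariety.Hom.toSchemeHom α) ∧
              Flat (AbelianVariety.Hom.toSchemeHom α) ∧ 0 < d ∧ φ ≫ φ = -(d • 𝟙 B) ∧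
              IsRationalClass w ∧ IsOfHodgeType B.dim B.X (2 * 2) 2 2 w ∧
              w ∈ weilClassesOf B φ 2 d ∧ w' = complexBetti.map α.hom.hom.hom (2 * 2) w}) :
    MoonenZarhin1999_hodgeClasses_abelian_dim_le_five_of_weilClassesFourfolds :=
  MoonenZarhin1999_hodgeClasses_abelian_dim_le_five_of_weilClassesFourfolds_of'
    (fun A _ b hb hbb ↦ by
      have hX : IsSmoothProjective A.dim A.X := AbelianVariety.isSmoothProjective_holds
      exact h1 hX b hb hbb)
    (fun A _ ↦ hL A.dim A.X) hMZ4 hMZ5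

/-! ### Where Moonen–Zarhin enters: granted (L11) and (HL), the fact is its codimension-`2` slice -/

/-- **Granted Lefschetz `(1,1)` and hard Lefschetz on abelian varieties of dimension `≤ 5`, the
Moonen–Zarhin reduction is EQUIVALENT to its codimension-`2` slice on abelian `4`- and `5`-folds**:
"the Weil classes of abelian fourfolds are algebraic ⇒ every rational `(2,2)`-class on every complex
abelian variety of dimension `4` or `5` is algebraic". The forward direction is specialisation; the
converse runs the assembly of `…_of'` with the slice in place of (MZ4)/(MZ5). This isolates exactly
the part of the fact that rests on Moonen–Zarhin's classification (Math. Ann. 315, Thms. 0.1–0.2: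
the exceptional classes in `B²` of abelian `4`- and `5`-folds are (pull-backs of) Weil classes).
[cite: MoonenZarhin1999LowDim, Thm. 0.1 and Thm. 0.2] [cite: VoisinHodgeI2002, Thm. 6.25 and Thm. 11.30]
[cite: KerrPearlstein2011, §3.1] -/
theorem MoonenZarhin1999_hodgeClasses_abelian_dim_le_five_of_weilClassesFourfolds_iff_codim_two
    (h1 : ∀ A : AbelianVariety ℂ, A.dim ≤ 5 → ∀ b : complexBetti A.X (2 * 1), IsRationalClass b →
      IsOfHodgeType A.dim A.X (2 * 1) 1 1 b → b ∈ algebraicClasses A.X 1)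
    (hL : ∀ A : AbelianVariety ℂ, A.dim ≤ 5 → nonempty_hardLefschetzNFold A.dim A.X) :
    MoonenZarhin1999_hodgeClasses_abelian_dim_le_five_of_weilClassesFourfolds ↔
      (Markman2025_weilClasses_algebraic_abelianFourfold →
        ∀ A : AbelianVariety ℂ, A.dim = 4 ∨ A.dim = 5 →
          ∀ c : complexBetti A.X (2 * 2), IsRationalClass c →
            IsOfHodgeType A.dim A.X (2 * 2) 2 2 c → c ∈ algebraicClasses A.X 2) := by
  refine ⟨fun h hW A hA c hc hcc ↦ h hW A (by omega) AbelianVariety.isSmoothProjective_holds 2 c hc hcc,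
    fun h ↦ ?_⟩
  intro hW A hd hX p c hc hpp
  have low : ∀ (q : ℕ) (c : complexBetti A.X (2 * q)), 2 * q ≤ A.dim → IsRationalClass c →
      IsOfHodgeType A.dim A.X (2 * q) q q c → c ∈ algebraicClasses A.X q := by
    intro q c hq hc hqq
    have hq2 : q ≤ 2 := by omega
    interval_cases q
    · exact hodgeConjectureFor_codim_zero c
    · exact h1 A hd c hc hqq
    · exact h hW A (by omega) c hc hqq
  rcases Nat.lt_or_ge A.dim (2 * p) with hlt | hge
  · exact mem_algebraicClasses_of_lt_of_nonempty (hL A hd) hX hlt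
      (fun c' hc' hpp' ↦ low (A.dim - p) c' (by omega) hc' hpp') c hc hpp
  · exact low p c hge hc hpp

/-- **Consistency of (MZ4) with the antecedent on its own summand**: granted the antecedent of the
fact, the Weil summand of (MZ4) — the span of the rational `(2,2)`-classes of all Weil planes of an
abelian fourfold — is algebraic (no Lefschetz input). [cite: Markman2025SurveySecant, Thm. 1.2 and §11.5 Step 2]
[cite: MoonenZarhin1999LowDim, (1.9)] -/
theorem span_weilHodgeClasses_le_algebraicClasses (hW : Markman2025_weilClasses_algebraic_abelianFourfold)
    (A : AbelianVariety ℂ) (hA : A.dim = 4) :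
    Submodule.span ℂ {w : complexBetti A.X (2 * 2) | ∃ (d : ℕ) (φ : A ⟶ A), 0 < d ∧
        φ ≫ φ = -(d • 𝟙 A) ∧ IsRationalClass w ∧ IsOfHodgeType A.dim A.X (2 * 2) 2 2 w ∧
        w ∈ weilClassesOf A φ 2 d} ≤ algebraicClasses A.X 2 := by
  have hX : IsSmoothProjective A.dim A.X := AbelianVariety.isSmoothProjective_holds
  have hA' : A.dim = 2 * 2 := hA
  refine Submodule.span_le.2 ?_
  rintro w ⟨d, φ, hd, hφ, hw, hw22, hwW⟩
  rw [hA'] at hw22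
  exact hW d hd A φ hA' (by rw [← hA']; exact hX) hφ w hw hw22 hwW

/-! ### With hard Lefschetz DISCHARGED (`nonempty_hardLefschetzNFold_holds`): the residue is Lefschetz `(1,1)` + (MZ4) + (MZ5)

Since the tree PROVES hard Lefschetz for the hyperplane class of every smooth projective complex
variety (`nonempty_hardLefschetzNFold_holds`, file `HardLefschetzNFoldHolds`; Voisin I Thm. 6.25 via
the Kähler package of the restricted Fubini–Study metric, relying on nothing unproved), input (HL)
of the assembly is a theorem, and the fact
`MoonenZarhin1999_hodgeClasses_abelian_dim_le_five_of_weilClassesFourfolds` rests on exactly three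
inputs: Lefschetz `(1,1)` (`lefschetzOneOne_rational`, itself reduced in the tree to the
Kodaira–Serre existence of sections, `lefschetzOneOne_rational_of_globalSections`) and the two
codimension-`2` generation statements of Moonen–Zarhin. -/

/-- **The Moonen–Zarhin reduction from Lefschetz `(1,1)` and the codimension-`2` parts of
Moonen–Zarhin's Thms. 0.1–0.2 alone** (hard Lefschetz being the tree's theorem
`nonempty_hardLefschetzNFold_holds`): `lefschetzOneOne_rational → (MZ4) → (MZ5) →
MoonenZarhin1999_hodgeClasses_abelian_dim_le_five_of_weilClassesFourfolds`.
[cite: MoonenZarhin1999LowDim, Thm. 0.1 and Thm. 0.2] [cite: Markman2025SurveySecant, §1.1 and proof of Cor. 1.3]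
[cite: VoisinHodgeI2002, Thm. 6.25 and Thm. 11.30] -/
theorem MoonenZarhin1999_hodgeClasses_abelian_dim_le_five_of_weilClassesFourfolds_of_lefschetzOneOne
    (h1 : lefschetzOneOne_rational)
    (hMZ4 : ∀ A : AbelianVariety ℂ, A.dim = 4 →
      ∀ c : complexBetti A.X (2 * 2), IsRationalClass c → IsOfHodgeType A.dim A.X (2 * 2) 2 2 c →
        c ∈ divisorClassesSpan A.X A.dim 2 ⊔
          Submodule.span ℂ {w : complexBetti A.X (2 * 2) | ∃ (d : ℕ) (φ : A ⟶ A), 0 < d ∧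
            φ ≫ φ = -(d • 𝟙 A) ∧ IsRationalClass w ∧ IsOfHodgeType A.dim A.X (2 * 2) 2 2 w ∧
            w ∈ weilClassesOf A φ 2 d})
    (hMZ5 : ∀ A : AbelianVariety ℂ, A.dim = 5 →
      ∀ c : complexBetti A.X (2 * 2), IsRationalClass c → IsOfHodgeType A.dim A.X (2 * 2) 2 2 c →
        c ∈ divisorClassesSpan A.X A.dim 2 ⊔
          Submodule.span ℂ {w' : complexBetti A.X (2 * 2) |
            ∃ (B : AbelianVariety ℂ) (α : A ⟶ B) (d : ℕ) (φ : B ⟶ B) (w : complexBetti B.X (2 * 2)),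
              B.dim = 4 ∧ Surjective (AbelianVariety.Hom.toSchemeHom α) ∧
              Flat (AbelianVariety.Hom.toSchemeHom α) ∧ 0 < d ∧ φ ≫ φ = -(d • 𝟙 B) ∧
              IsRationalClass w ∧ IsOfHodgeType B.dim B.X (2 * 2) 2 2 w ∧
              w ∈ weilClassesOf B φ 2 d ∧ w' = complexBetti.map α.hom.hom.hom (2 * 2) w}) :
    MoonenZarhin1999_hodgeClasses_abelian_dim_le_five_of_weilClassesFourfolds :=
  MoonenZarhin1999_hodgeClasses_abelian_dim_le_five_of_weilClassesFourfolds_of h1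
    (fun n X ↦ @nonempty_hardLefschetzNFold_holds n X) hMZ4 hMZ5

/-- **Granted Lefschetz `(1,1)` on abelian varieties of dimension `≤ 5` ALONE, the Moonen–Zarhin
reduction is equivalent to its codimension-`2` slice on abelian `4`- and `5`-folds** (hard Lefschetz
being the tree's theorem `nonempty_hardLefschetzNFold_holds`): `…_iff_codim_two` with (HL)
discharged. [cite: MoonenZarhin1999LowDim, Thm. 0.1 and Thm. 0.2] [cite: VoisinHodgeI2002, Thm. 6.25 and Thm. 11.30]
[cite: KerrPearlstein2011, §3.1] -/
theorem MoonenZarhin1999_hodgeClasses_abelian_dim_le_five_of_weilClassesFourfolds_iff_codim_two'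
    (h1 : ∀ A : AbelianVariety ℂ, A.dim ≤ 5 → ∀ b : complexBetti A.X (2 * 1), IsRationalClass b →
      IsOfHodgeType A.dim A.X (2 * 1) 1 1 b → b ∈ algebraicClasses A.X 1) :
    MoonenZarhin1999_hodgeClasses_abelian_dim_le_five_of_weilClassesFourfolds ↔
      (Markman2025_weilClasses_algebraic_abelianFourfold →
        ∀ A : AbelianVariety ℂ, A.dim = 4 ∨ A.dim = 5 →
          ∀ c : complexBetti A.X (2 * 2), IsRationalClass c →
            IsOfHodgeType A.dim A.X (2 * 2) 2 2 c → c ∈ algebraicClasses A.X 2) :=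
  MoonenZarhin1999_hodgeClasses_abelian_dim_le_five_of_weilClassesFourfolds_iff_codim_two h1
    fun A _ ↦ @nonempty_hardLefschetzNFold_holds A.dim A.X

/-- **Granted the named fact `lefschetzOneOne_rational` alone, the Moonen–Zarhin reduction is
equivalent to its codimension-`2` slice on abelian `4`- and `5`-folds**: what remains of the fact
beyond Lefschetz `(1,1)` is precisely "the Weil classes of abelian fourfolds are algebraic ⇒ every
rational `(2,2)`-class on every complex abelian `4`- or `5`-fold is algebraic" — the content of
Moonen–Zarhin's Thms. 0.1–0.2 in codimension `2`. [cite: MoonenZarhin1999LowDim, Thm. 0.1 and Thm. 0.2]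
[cite: VoisinHodgeI2002, Thm. 6.25 and Thm. 11.30] -/
theorem MoonenZarhin1999_hodgeClasses_abelian_dim_le_five_of_weilClassesFourfolds_iff_codim_two_of_lefschetzOneOne
    (h1 : lefschetzOneOne_rational) :
    MoonenZarhin1999_hodgeClasses_abelian_dim_le_five_of_weilClassesFourfolds ↔
      (Markman2025_weilClasses_algebraic_abelianFourfold →
        ∀ A : AbelianVariety ℂ, A.dim = 4 ∨ A.dim = 5 →
          ∀ c : complexBetti A.X (2 * 2), IsRationalClass c →
            IsOfHodgeType A.dim A.X (2 * 2) 2 2 c → c ∈ algebraicClasses A.X 2) :=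
  MoonenZarhin1999_hodgeClasses_abelian_dim_le_five_of_weilClassesFourfolds_iff_codim_two'
    fun A _ b hb hbb ↦ by
      have hX : IsSmoothProjective A.dim A.X := AbelianVariety.isSmoothProjective_holds
      exact h1 hX b hb hbb

/-- **The complete printed trust chain in the tree's finest proved currency**: the Moonen–Zarhin
reduction follows from (KS) the Kodaira–Serre existence of sections — for every cocycle holomorphic
line bundle `L` on a Hodge model of a smooth projective complex variety, some `L'` with non-zero
global holomorphic sections of `L ⊗ L'` and of `L'` (Voisin I, proof of Cor. 11.34 via Thm. 7.11:
`L' = H^{⊗N}`, `N ≫ 0`), which is all that the tree's proof of Lefschetz `(1,1)` still takes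
(`lefschetzOneOne_rational_of_globalSections`, file `LefschetzOneOneOfGlobalSections`) — together
with (MZ4) and (MZ5); hard Lefschetz is the theorem `nonempty_hardLefschetzNFold_holds`.
[cite: VoisinHodgeI2002, Cor. 11.34 (proof), Thm. 7.11 and Thm. 11.30]
[cite: MoonenZarhin1999LowDim, Thm. 0.1 and Thm. 0.2] [cite: Markman2025SurveySecant, §1.1 and proof of Cor. 1.3] -/
theorem MoonenZarhin1999_hodgeClasses_abelian_dim_le_five_of_weilClassesFourfolds_of_globalSections
    (hKS : ∀ ⦃n : ℕ⦄ ⦃X : Motives.SchemeOver ℂ⦄, Motives.IsSmoothProjective n X →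
      ∀ (M : HodgeModel n X) (ι : Type)
        (L : Literature.Geometry.Kaehler.HolomorphicLineBundle ι M.model M.carrier),
        ∃ (κ : Type) (L' : Literature.Geometry.Kaehler.HolomorphicLineBundle κ M.model M.carrier)
          (σ₁ : (L.tensor L').GlobalSection) (σ₂ : L'.GlobalSection),
          σ₁.zeroSet ≠ Set.univ ∧ σ₂.zeroSet ≠ Set.univ)
    (hMZ4 : ∀ A : AbelianVariety ℂ, A.dim = 4 →
      ∀ c : complexBetti A.X (2 * 2), IsRationalClass c → IsOfHodgeType A.dim A.X (2 * 2) 2 2 c →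
        c ∈ divisorClassesSpan A.X A.dim 2 ⊔
          Submodule.span ℂ {w : complexBetti A.X (2 * 2) | ∃ (d : ℕ) (φ : A ⟶ A), 0 < d ∧
            φ ≫ φ = -(d • 𝟙 A) ∧ IsRationalClass w ∧ IsOfHodgeType A.dim A.X (2 * 2) 2 2 w ∧
            w ∈ weilClassesOf A φ 2 d})
    (hMZ5 : ∀ A : AbelianVariety ℂ, A.dim = 5 →
      ∀ c : complexBetti A.X (2 * 2), IsRationalClass c → IsOfHodgeType A.dim A.X (2 * 2) 2 2 c →
        c ∈ divisorClassesSpan A.X A.dim 2 ⊔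
          Submodule.span ℂ {w' : complexBetti A.X (2 * 2) |
            ∃ (B : AbelianVariety ℂ) (α : A ⟶ B) (d : ℕ) (φ : B ⟶ B) (w : complexBetti B.X (2 * 2)),
              B.dim = 4 ∧ Surjective (AbelianVariety.Hom.toSchemeHom α) ∧
              Flat (AbelianVariety.Hom.toSchemeHom α) ∧ 0 < d ∧ φ ≫ φ = -(d • 𝟙 B) ∧
              IsRationalClass w ∧ IsOfHodgeType B.dim B.X (2 * 2) 2 2 w ∧
              w ∈ weilClassesOf B φ 2 d ∧ w' = complexBetti.map α.hom.hom.hom (2 * 2) w}) :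
    MoonenZarhin1999_hodgeClasses_abelian_dim_le_five_of_weilClassesFourfolds :=
  MoonenZarhin1999_hodgeClasses_abelian_dim_le_five_of_weilClassesFourfolds_of_lefschetzOneOne
    (lefschetzOneOne_rational_of_globalSections hKS) hMZ4 hMZ5

/-! ### (MZ5⁺): pull-backs along ARBITRARY morphisms to abelian fourfolds — no flatness, no surjectivity

The tree proves that pull-back along any `ℂ`-morphism `g : X → B` from a smooth projective
variety to an abelian variety carries `Nᵖ H²ᵖ(B(ℂ); ℂ)` into `Nᵖ H²ᵖ(X(ℂ); ℂ)`
(`map_mem_algebraicClasses_of_abelianVariety`, file `AbelianVarietyPullbackAlgebraicClasses`: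
`g = i_a ≫ μ_g` with `μ_g(x, b) = g(x) · b` flat, and a general slice of an algebraic class is
algebraic — Kleiman's general translate, Fulton App. B.9.2 (a), Cor. 19.2 (b)). Hence the
codimension-`2` input on fivefolds may be taken with the LARGER generating set of all pull-backs
`g^* w` of rational `(2,2)` Weil classes `w` of abelian fourfolds `B` along all morphisms
`g : A ⟶ B` — a hypothesis weaker than (MZ5) (whose generators, the pull-backs along flat
surjective homomorphisms, are among these), so a fortiori implied by Moonen–Zarhin's Thm. 0.2 as
printed ("the pull-backs of the Weil classes in `W_k ⊂ B²(X₁ × X₂)`" along a surjective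
homomorphism `X → X₁ × X₂`), and free of the miracle-flatness proviso. The assembly below is the
converse direction of `…_iff_codim_two'` fed with `mem_algebraicClasses_two_of_dim_eq_four` and
the following fivefold step. -/

/-- **The codimension-`2` step on an abelian fivefold, pull-backs along arbitrary morphisms.**
Granted the antecedent of the fact and Lefschetz `(1,1)` on `A`, every class of `H⁴(A(ℂ); ℂ)` in
`(D² ⊗ ℂ) + span_ℂ {g^* w : B an abelian FOURFOLD, g : A ⟶ B any ℂ-morphism, w a rational (2,2) Weil class of (B, φ, d)}`
is algebraic: `w ∈ N² H⁴(B)` by the antecedent, and `g^* N² H⁴(B) ⊆ N² H⁴(A)`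
(`map_mem_algebraicClasses_of_abelianVariety`). Moonen–Zarhin's Thm. 0.2 puts every Hodge class of
`B²` of an abelian fivefold in the span of `D²` and the pull-backs of Weil classes of quotient
abelian fourfolds along surjective homomorphisms — a subset of these generators.
[cite: MoonenZarhin1999LowDim, Thm. 0.2 and (1.9)] [cite: Markman2025SurveySecant, §1.1 (before Cor. 1.3)]
[cite: Fulton1998, §19.2 Cor. 19.2 (b) and Appendix B.9.2 (a)] -/
theorem mem_algebraicClasses_two_of_dim_eq_five' (hW : Markman2025_weilClasses_algebraic_abelianFourfold)
    (A : AbelianVariety ℂ)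
    (h11 : ∀ b : complexBetti A.X (2 * 1), IsRationalClass b → IsOfHodgeType A.dim A.X (2 * 1) 1 1 b →
      b ∈ algebraicClasses A.X 1)
    {c : complexBetti A.X (2 * 2)}
    (hc : c ∈ divisorClassesSpan A.X A.dim 2 ⊔
      Submodule.span ℂ {w' : complexBetti A.X (2 * 2) |
        ∃ (B : AbelianVariety ℂ) (g : A.X ⟶ B.X) (d : ℕ) (φ : B ⟶ B) (w : complexBetti B.X (2 * 2)),
          B.dim = 4 ∧ 0 < d ∧ φ ≫ φ = -(d • 𝟙 B) ∧
          IsRationalClass w ∧ IsOfHodgeType B.dim B.X (2 * 2) 2 2 w ∧ w ∈ weilClassesOf B φ 2 d ∧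
          w' = complexBetti.map g (2 * 2) w}) :
    c ∈ algebraicClasses A.X 2 := by
  refine (sup_le (AbelianVariety.divisorClassesSpan_le_algebraicClasses A h11 2)
    (Submodule.span_le.2 ?_)) hc
  rintro w' ⟨B, g, d, φ, w, hB, hd, hφ, hw, hw22, hwW, rfl⟩
  have hXA : IsSmoothProjective A.dim A.X := AbelianVariety.isSmoothProjective_holds
  have hXB : IsSmoothProjective B.dim B.X := AbelianVariety.isSmoothProjective_holds
  have hB' : B.dim = 2 * 2 := hB
  rw [hB'] at hw22
  have hwalg : w ∈ algebraicClasses B.X 2 :=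
    hW d hd B φ hB' (by rw [← hB']; exact hXB) hφ w hw hw22 hwW
  exact map_mem_algebraicClasses_of_abelianVariety hXA B g hwalg

/-- **The Moonen–Zarhin reduction from its codimension-`≤ 2` inputs on abelian varieties of
dimension `≤ 5`, pull-backs unrestricted** (hard Lefschetz being the tree's theorem
`nonempty_hardLefschetzNFold_holds`, general pull-backs to abelian varieties being the tree's
theorem `map_mem_algebraicClasses_of_abelianVariety`): IF (L11) every rational `(1,1)`-class on a
complex abelian variety of dimension `≤ 5` is algebraic, (MZ4) on every abelian fourfold every
rational `(2,2)`-class lies in `(D² ⊗ ℂ) + span_ℂ {rational (2,2) Weil classes}` (Moonen–Zarhin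
1999 Thm. 0.1, with Moonen–Zarhin 1995 and Ramón Marí 2008 Prop. 2.18), and (MZ5⁺) on every
abelian fivefold every rational `(2,2)`-class lies in `(D² ⊗ ℂ) + span_ℂ {g^* w}` over all
morphisms `g` to abelian fourfolds and their rational `(2,2)` Weil classes `w` (implied by ibid.
Thm. 0.2, whose generators are the pull-backs along surjective homomorphisms; Tankeev for simple
fivefolds), THEN `MoonenZarhin1999_hodgeClasses_abelian_dim_le_five_of_weilClassesFourfolds`. This
is the residue of the fact in the tree: Lefschetz `(1,1)` on abelian varieties of dimension `≤ 5`
and the two codimension-`2` generation theorems, nothing else. [cite: MoonenZarhin1999LowDim, Thm. 0.1 and Thm. 0.2]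
[cite: Markman2025SurveySecant, §1.1 and proof of Cor. 1.3] [cite: RamonMari2008, Prop. 2.18]
[cite: MoonenZarhin1995Duke, main theorem] [cite: VoisinHodgeI2002, Thm. 6.25 and Thm. 11.30]
[cite: Fulton1998, §19.2 Cor. 19.2 (b)] -/
theorem MoonenZarhin1999_hodgeClasses_abelian_dim_le_five_of_weilClassesFourfolds_of_codim_two
    (h1 : ∀ A : AbelianVariety ℂ, A.dim ≤ 5 → ∀ b : complexBetti A.X (2 * 1), IsRationalClass b →
      IsOfHodgeType A.dim A.X (2 * 1) 1 1 b → b ∈ algebraicClasses A.X 1)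
    (hMZ4 : ∀ A : AbelianVariety ℂ, A.dim = 4 →
      ∀ c : complexBetti A.X (2 * 2), IsRationalClass c → IsOfHodgeType A.dim A.X (2 * 2) 2 2 c →
        c ∈ divisorClassesSpan A.X A.dim 2 ⊔
          Submodule.span ℂ {w : complexBetti A.X (2 * 2) | ∃ (d : ℕ) (φ : A ⟶ A), 0 < d ∧
            φ ≫ φ = -(d • 𝟙 A) ∧ IsRationalClass w ∧ IsOfHodgeType A.dim A.X (2 * 2) 2 2 w ∧
            w ∈ weilClassesOf A φ 2 d})
    (hMZ5 : ∀ A : AbelianVariety ℂ, A.dim = 5 →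
      ∀ c : complexBetti A.X (2 * 2), IsRationalClass c → IsOfHodgeType A.dim A.X (2 * 2) 2 2 c →
        c ∈ divisorClassesSpan A.X A.dim 2 ⊔
          Submodule.span ℂ {w' : complexBetti A.X (2 * 2) |
            ∃ (B : AbelianVariety ℂ) (g : A.X ⟶ B.X) (d : ℕ) (φ : B ⟶ B) (w : complexBetti B.X (2 * 2)),
              B.dim = 4 ∧ 0 < d ∧ φ ≫ φ = -(d • 𝟙 B) ∧
              IsRationalClass w ∧ IsOfHodgeType B.dim B.X (2 * 2) 2 2 w ∧
              w ∈ weilClassesOf B φ 2 d ∧ w' = complexBetti.map g (2 * 2) w}) :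
    MoonenZarhin1999_hodgeClasses_abelian_dim_le_five_of_weilClassesFourfolds :=
  (MoonenZarhin1999_hodgeClasses_abelian_dim_le_five_of_weilClassesFourfolds_iff_codim_two' h1).2
    fun hW A hA c hc hcc ↦ by
      rcases hA with h4 | h5
      · exact mem_algebraicClasses_two_of_dim_eq_four hW A h4 (h1 A (by omega)) (hMZ4 A h4 c hc hcc)
      · exact mem_algebraicClasses_two_of_dim_eq_five' hW A (h1 A (by omega)) (hMZ5 A h5 c hc hcc)

/-- **The Moonen–Zarhin reduction from the named fact `lefschetzOneOne_rational` and the two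
codimension-`2` generation theorems, pull-backs unrestricted**: `lefschetzOneOne_rational → (MZ4) →
(MZ5⁺) → MoonenZarhin1999_hodgeClasses_abelian_dim_le_five_of_weilClassesFourfolds` — the form in
which the fact is discharged the day (L11), (MZ4), (MZ5⁺) are theorems of the tree.
[cite: MoonenZarhin1999LowDim, Thm. 0.1 and Thm. 0.2] [cite: Markman2025SurveySecant, §1.1 and proof of Cor. 1.3]
[cite: VoisinHodgeI2002, Thm. 6.25 and Thm. 11.30] -/
theorem MoonenZarhin1999_hodgeClasses_abelian_dim_le_five_of_weilClassesFourfolds_of_lefschetzOneOne'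
    (h1 : lefschetzOneOne_rational)
    (hMZ4 : ∀ A : AbelianVariety ℂ, A.dim = 4 →
      ∀ c : complexBetti A.X (2 * 2), IsRationalClass c → IsOfHodgeType A.dim A.X (2 * 2) 2 2 c →
        c ∈ divisorClassesSpan A.X A.dim 2 ⊔
          Submodule.span ℂ {w : complexBetti A.X (2 * 2) | ∃ (d : ℕ) (φ : A ⟶ A), 0 < d ∧
            φ ≫ φ = -(d • 𝟙 A) ∧ IsRationalClass w ∧ IsOfHodgeType A.dim A.X (2 * 2) 2 2 w ∧
            w ∈ weilClassesOf A φ 2 d})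
    (hMZ5 : ∀ A : AbelianVariety ℂ, A.dim = 5 →
      ∀ c : complexBetti A.X (2 * 2), IsRationalClass c → IsOfHodgeType A.dim A.X (2 * 2) 2 2 c →
        c ∈ divisorClassesSpan A.X A.dim 2 ⊔
          Submodule.span ℂ {w' : complexBetti A.X (2 * 2) |
            ∃ (B : AbelianVariety ℂ) (g : A.X ⟶ B.X) (d : ℕ) (φ : B ⟶ B) (w : complexBetti B.X (2 * 2)),
              B.dim = 4 ∧ 0 < d ∧ φ ≫ φ = -(d • 𝟙 B) ∧
              IsRationalClass w ∧ IsOfHodgeType B.dim B.X (2 * 2) 2 2 w ∧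
              w ∈ weilClassesOf B φ 2 d ∧ w' = complexBetti.map g (2 * 2) w}) :
    MoonenZarhin1999_hodgeClasses_abelian_dim_le_five_of_weilClassesFourfolds :=
  MoonenZarhin1999_hodgeClasses_abelian_dim_le_five_of_weilClassesFourfolds_of_codim_two
    (fun A _ b hb hbb ↦ by
      have hX : IsSmoothProjective A.dim A.X := AbelianVariety.isSmoothProjective_holds
      exact h1 hX b hb hbb)
    hMZ4 hMZ5

/-- **The complete printed trust chain, pull-backs unrestricted**: the Moonen–Zarhin reduction
from (KS) the Kodaira–Serre existence of sections (all that the tree's proof of Lefschetz `(1,1)`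
still takes, `lefschetzOneOne_rational_of_globalSections`) together with (MZ4) and (MZ5⁺).
[cite: VoisinHodgeI2002, Cor. 11.34 (proof), Thm. 7.11 and Thm. 11.30]
[cite: MoonenZarhin1999LowDim, Thm. 0.1 and Thm. 0.2] [cite: Markman2025SurveySecant, §1.1 and proof of Cor. 1.3] -/
theorem MoonenZarhin1999_hodgeClasses_abelian_dim_le_five_of_weilClassesFourfolds_of_globalSections'
    (hKS : ∀ ⦃n : ℕ⦄ ⦃X : Motives.SchemeOver ℂ⦄, Motives.IsSmoothProjective n X →
      ∀ (M : HodgeModel n X) (ι : Type)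
        (L : Literature.Geometry.Kaehler.HolomorphicLineBundle ι M.model M.carrier),
        ∃ (κ : Type) (L' : Literature.Geometry.Kaehler.HolomorphicLineBundle κ M.model M.carrier)
          (σ₁ : (L.tensor L').GlobalSection) (σ₂ : L'.GlobalSection),
          σ₁.zeroSet ≠ Set.univ ∧ σ₂.zeroSet ≠ Set.univ)
    (hMZ4 : ∀ A : AbelianVariety ℂ, A.dim = 4 →
      ∀ c : complexBetti A.X (2 * 2), IsRationalClass c → IsOfHodgeType A.dim A.X (2 * 2) 2 2 c →
        c ∈ divisorClassesSpan A.X A.dim 2 ⊔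
          Submodule.span ℂ {w : complexBetti A.X (2 * 2) | ∃ (d : ℕ) (φ : A ⟶ A), 0 < d ∧
            φ ≫ φ = -(d • 𝟙 A) ∧ IsRationalClass w ∧ IsOfHodgeType A.dim A.X (2 * 2) 2 2 w ∧
            w ∈ weilClassesOf A φ 2 d})
    (hMZ5 : ∀ A : AbelianVariety ℂ, A.dim = 5 →
      ∀ c : complexBetti A.X (2 * 2), IsRationalClass c → IsOfHodgeType A.dim A.X (2 * 2) 2 2 c →
        c ∈ divisorClassesSpan A.X A.dim 2 ⊔
          Submodule.span ℂ {w' : complexBetti A.X (2 * 2) |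
            ∃ (B : AbelianVariety ℂ) (g : A.X ⟶ B.X) (d : ℕ) (φ : B ⟶ B) (w : complexBetti B.X (2 * 2)),
              B.dim = 4 ∧ 0 < d ∧ φ ≫ φ = -(d • 𝟙 B) ∧
              IsRationalClass w ∧ IsOfHodgeType B.dim B.X (2 * 2) 2 2 w ∧
              w ∈ weilClassesOf B φ 2 d ∧ w' = complexBetti.map g (2 * 2) w}) :
    MoonenZarhin1999_hodgeClasses_abelian_dim_le_five_of_weilClassesFourfolds :=
  MoonenZarhin1999_hodgeClasses_abelian_dim_le_five_of_weilClassesFourfolds_of_lefschetzOneOne'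
    (lefschetzOneOne_rational_of_globalSections hKS) hMZ4 hMZ5

/-- **Monotonicity: (MZ5) implies (MZ5⁺)** — the printed generating set (pull-backs along flat
surjective homomorphisms onto abelian fourfolds) lies in the enlarged one (pull-backs along all
morphisms), so every consumer of (MZ5⁺) also accepts (MZ5). [folklore] -/
theorem span_pullback_weilClasses_mono (A : AbelianVariety ℂ) :
    Submodule.span ℂ {w' : complexBetti A.X (2 * 2) |
        ∃ (B : AbelianVariety ℂ) (α : A ⟶ B) (d : ℕ) (φ : B ⟶ B) (w : complexBetti B.X (2 * 2)),
          B.dim = 4 ∧ Surjective (AbelianVariety.Hom.toSchemeHom α) ∧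
          Flat (AbelianVariety.Hom.toSchemeHom α) ∧ 0 < d ∧ φ ≫ φ = -(d • 𝟙 B) ∧
          IsRationalClass w ∧ IsOfHodgeType B.dim B.X (2 * 2) 2 2 w ∧
          w ∈ weilClassesOf B φ 2 d ∧ w' = complexBetti.map α.hom.hom.hom (2 * 2) w} ≤
      Submodule.span ℂ {w' : complexBetti A.X (2 * 2) |
        ∃ (B : AbelianVariety ℂ) (g : A.X ⟶ B.X) (d : ℕ) (φ : B ⟶ B) (w : complexBetti B.X (2 * 2)),
          B.dim = 4 ∧ 0 < d ∧ φ ≫ φ = -(d • 𝟙 B) ∧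
          IsRationalClass w ∧ IsOfHodgeType B.dim B.X (2 * 2) 2 2 w ∧
          w ∈ weilClassesOf B φ 2 d ∧ w' = complexBetti.map g (2 * 2) w} := by
  refine Submodule.span_mono ?_
  rintro w' ⟨B, α, d, φ, w, hB, -, -, hd, hφ, hw, hw22, hwW, rfl⟩
  exact ⟨B, α.hom.hom.hom, d, φ, w, hB, hd, hφ, hw, hw22, hwW, rfl⟩

/-! ### ONE codimension-`2` hypothesis (MZ) for dimensions `4` and `5`, and the NAMED leaf of (L11)

The two codimension-`2` inputs merge into a single statement of the same shape in both dimensions,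
(MZ): *on every complex abelian variety `A` of dimension `4` or `5`, every rational `(2,2)`-class lies
in `(D² ⊗ ℂ) + span_ℂ {g^* w : B an abelian fourfold, g : A ⟶ B a ℂ-morphism, w a rational (2,2)
class of a Weil plane weilClassesOf B φ 2 d}`* — for `A.dim = 5` this is (MZ5⁺) verbatim, and for
`A.dim = 4` its generating set CONTAINS that of (MZ4) (`w = (𝟙 A)^* w`,
`span_weilHodgeClasses_le_span_pullback`), so (MZ) is implied by (MZ4) ∧ (MZ5⁺)
(`codim_two_pullback_of_codim_two`), hence a fortiori by Moonen–Zarhin's Thms. 0.1–0.2 with Ramón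
Marí's Prop. 2.18, exactly as (MZ4), (MZ5⁺) are (module docstring, "Faithfulness"); it is the
codimension-`2` content of "the Hodge ring … is generated by divisor classes and (pull-backs of) Weil
classes of abelian fourfolds" in the one currency the fivefold step `mem_algebraicClasses_two_of_dim_eq_five'`
consumes in BOTH dimensions (that step never used `A.dim = 5`).

On the other side, the tree now reduces Lefschetz `(1,1)` to ONE named fact: `lefschetzOneOne_rational`
⟸ `kodairaSerre_exists_globalSection_algebraicTwist` (`lefschetzOneOne_rational_of_kodairaSerre_fact`,
file `LefschetzOneOneOfKodairaSerre`) ⟸ `serreGAGA_lineCocycle_iso_cartierDivisorCocycle`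
(`kodairaSerre_exists_globalSection_algebraicTwist_of_serreGAGA`, file `KodairaSerreSectionsProofs`;
directly `lefschetzOneOne_rational_of_serreGAGA`, file `LefschetzOneOneOfGAGA`) — J.-P. Serre, GAGA
(1956) n° 20 Prop. 18 for `r = 1`: every holomorphic line cocycle on `X^an`, `X` smooth projective, is
holomorphically isomorphic to some `𝒪_X(D)^an`. Hence the fact rests on exactly
{`serreGAGA_lineCocycle_iso_cartierDivisorCocycle`, (MZ)}: `…_of_serreGAGA` below, and
`theorem …_holds := …_of_serreGAGA serreGAGA_lineCocycle_iso_cartierDivisorCocycle_holds ‹(MZ)›` the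
day both are theorems of the tree. -/

/-- **The generators of (MZ4) are among those of (MZ)**: a rational `(2,2)` Weil class `w` of the
abelian fourfold `A` itself is the pull-back `(𝟙 A)^* w` along the identity to the fourfold `A`.
[folklore] -/
theorem span_weilHodgeClasses_le_span_pullback (A : AbelianVariety ℂ) (hA : A.dim = 4) :
    Submodule.span ℂ {w : complexBetti A.X (2 * 2) | ∃ (d : ℕ) (φ : A ⟶ A), 0 < d ∧
        φ ≫ φ = -(d • 𝟙 A) ∧ IsRationalClass w ∧ IsOfHodgeType A.dim A.X (2 * 2) 2 2 w ∧
        w ∈ weilClassesOf A φ 2 d} ≤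
      Submodule.span ℂ {w' : complexBetti A.X (2 * 2) |
        ∃ (B : AbelianVariety ℂ) (g : A.X ⟶ B.X) (d : ℕ) (φ : B ⟶ B) (w : complexBetti B.X (2 * 2)),
          B.dim = 4 ∧ 0 < d ∧ φ ≫ φ = -(d • 𝟙 B) ∧
          IsRationalClass w ∧ IsOfHodgeType B.dim B.X (2 * 2) 2 2 w ∧
          w ∈ weilClassesOf B φ 2 d ∧ w' = complexBetti.map g (2 * 2) w} := by
  refine Submodule.span_mono ?_
  rintro w ⟨d, φ, hd, hφ, hw, hw22, hwW⟩
  exact ⟨A, 𝟙 A.X, d, φ, w, hA, hd, hφ, hw, hw22, hwW, by rw [complexBetti.map_id]; rfl⟩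

/-- **(MZ4) ∧ (MZ5⁺) ⇒ (MZ)**: the single codimension-`2` hypothesis for abelian varieties of
dimension `4` or `5` follows from the two separate ones (dimension `4`: enlarge the generating set by
`span_weilHodgeClasses_le_span_pullback`; dimension `5`: verbatim). Both sides are implied by
Moonen–Zarhin's Thms. 0.1–0.2 (codimension-`2` parts). [cite: MoonenZarhin1999LowDim, Thm. 0.1 and Thm. 0.2] -/
theorem codim_two_pullback_of_codim_two
    (hMZ4 : ∀ A : AbelianVariety ℂ, A.dim = 4 →
      ∀ c : complexBetti A.X (2 * 2), IsRationalClass c → IsOfHodgeType A.dim A.X (2 * 2) 2 2 c →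
        c ∈ divisorClassesSpan A.X A.dim 2 ⊔
          Submodule.span ℂ {w : complexBetti A.X (2 * 2) | ∃ (d : ℕ) (φ : A ⟶ A), 0 < d ∧
            φ ≫ φ = -(d • 𝟙 A) ∧ IsRationalClass w ∧ IsOfHodgeType A.dim A.X (2 * 2) 2 2 w ∧
            w ∈ weilClassesOf A φ 2 d})
    (hMZ5 : ∀ A : AbelianVariety ℂ, A.dim = 5 →
      ∀ c : complexBetti A.X (2 * 2), IsRationalClass c → IsOfHodgeType A.dim A.X (2 * 2) 2 2 c →
        c ∈ divisorClassesSpan A.X A.dim 2 ⊔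
          Submodule.span ℂ {w' : complexBetti A.X (2 * 2) |
            ∃ (B : AbelianVariety ℂ) (g : A.X ⟶ B.X) (d : ℕ) (φ : B ⟶ B) (w : complexBetti B.X (2 * 2)),
              B.dim = 4 ∧ 0 < d ∧ φ ≫ φ = -(d • 𝟙 B) ∧
              IsRationalClass w ∧ IsOfHodgeType B.dim B.X (2 * 2) 2 2 w ∧
              w ∈ weilClassesOf B φ 2 d ∧ w' = complexBetti.map g (2 * 2) w})
    (A : AbelianVariety ℂ) (hA : A.dim = 4 ∨ A.dim = 5)
    (c : complexBetti A.X (2 * 2)) (hc : IsRationalClass c) (hcc : IsOfHodgeType A.dim A.X (2 * 2) 2 2 c) :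
    c ∈ divisorClassesSpan A.X A.dim 2 ⊔
      Submodule.span ℂ {w' : complexBetti A.X (2 * 2) |
        ∃ (B : AbelianVariety ℂ) (g : A.X ⟶ B.X) (d : ℕ) (φ : B ⟶ B) (w : complexBetti B.X (2 * 2)),
          B.dim = 4 ∧ 0 < d ∧ φ ≫ φ = -(d • 𝟙 B) ∧
          IsRationalClass w ∧ IsOfHodgeType B.dim B.X (2 * 2) 2 2 w ∧
          w ∈ weilClassesOf B φ 2 d ∧ w' = complexBetti.map g (2 * 2) w} := by
  rcases hA with h4 | h5
  · exact sup_le_sup_left (span_weilHodgeClasses_le_span_pullback A h4) _ (hMZ4 A h4 c hc hcc)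
  · exact hMZ5 A h5 c hc hcc

/-- **The Moonen–Zarhin reduction from Lefschetz `(1,1)` on abelian varieties of dimension `≤ 5` and
the single codimension-`2` hypothesis (MZ)** (hard Lefschetz and general pull-backs to abelian
varieties being theorems of the tree): IF (L11) every rational `(1,1)`-class on a complex abelian
variety of dimension `≤ 5` is algebraic and (MZ) on every complex abelian variety of dimension `4` or
`5` every rational `(2,2)`-class lies in `(D² ⊗ ℂ) + span_ℂ {g^* w}` over all morphisms `g` to abelian
fourfolds `B` and all rational `(2,2)` classes `w` of the Weil planes of `B` — Moonen–Zarhin, Math.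
Ann. 315 (1999), Thm. 0.1 (fourfolds: "generated by the subalgebra `D•(X)` of divisor classes together
with the space(s) of Weil classes `W_k ⊂ B²(X)`", else `B• = D•`; products of abelian surfaces:
Ramón Marí 2008 Prop. 2.18) and Thm. 0.2 (fivefolds: "generated by the divisor classes `D•(X)`
together with the pull-backs of the Weil classes in `W_k ⊂ B²(X₁ × X₂)`", else by divisor classes /
the Hodge rings of the factors), codimension-`2` parts — THEN
`MoonenZarhin1999_hodgeClasses_abelian_dim_le_five_of_weilClassesFourfolds`. Proof: the converse
direction of `…_iff_codim_two'` fed, in both dimensions, with `mem_algebraicClasses_two_of_dim_eq_five'`.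
[cite: MoonenZarhin1999LowDim, Thm. 0.1, Thm. 0.2 and (1.9)] [cite: Markman2025SurveySecant, §1.1 and proof of Cor. 1.3]
[cite: RamonMari2008, Prop. 2.18] [cite: VoisinHodgeI2002, Thm. 6.25 and Thm. 11.30]
[cite: Fulton1998, §19.2 Cor. 19.2 (b) and Appendix B.9.2 (a)] -/
theorem MoonenZarhin1999_hodgeClasses_abelian_dim_le_five_of_weilClassesFourfolds_of_codim_two_pullback
    (h1 : ∀ A : AbelianVariety ℂ, A.dim ≤ 5 → ∀ b : complexBetti A.X (2 * 1), IsRationalClass b →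
      IsOfHodgeType A.dim A.X (2 * 1) 1 1 b → b ∈ algebraicClasses A.X 1)
    (hMZ : ∀ A : AbelianVariety ℂ, A.dim = 4 ∨ A.dim = 5 →
      ∀ c : complexBetti A.X (2 * 2), IsRationalClass c → IsOfHodgeType A.dim A.X (2 * 2) 2 2 c →
        c ∈ divisorClassesSpan A.X A.dim 2 ⊔
          Submodule.span ℂ {w' : complexBetti A.X (2 * 2) |
            ∃ (B : AbelianVariety ℂ) (g : A.X ⟶ B.X) (d : ℕ) (φ : B ⟶ B) (w : complexBetti B.X (2 * 2)),
              B.dim = 4 ∧ 0 < d ∧ φ ≫ φ = -(d • 𝟙 B) ∧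
              IsRationalClass w ∧ IsOfHodgeType B.dim B.X (2 * 2) 2 2 w ∧
              w ∈ weilClassesOf B φ 2 d ∧ w' = complexBetti.map g (2 * 2) w}) :
    MoonenZarhin1999_hodgeClasses_abelian_dim_le_five_of_weilClassesFourfolds :=
  (MoonenZarhin1999_hodgeClasses_abelian_dim_le_five_of_weilClassesFourfolds_iff_codim_two' h1).2
    fun hW A hA c hc hcc ↦
      mem_algebraicClasses_two_of_dim_eq_five' hW A (h1 A (by rcases hA with h | h <;> omega))
        (hMZ A hA c hc hcc)

/-- **`lefschetzOneOne_rational → (MZ) → MoonenZarhin1999_hodgeClasses_abelian_dim_le_five_of_weilClassesFourfolds`.**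
[cite: MoonenZarhin1999LowDim, Thm. 0.1 and Thm. 0.2] [cite: VoisinHodgeI2002, Thm. 6.25 and Thm. 11.30] -/
theorem MoonenZarhin1999_hodgeClasses_abelian_dim_le_five_of_weilClassesFourfolds_of_lefschetzOneOne_pullback
    (h1 : lefschetzOneOne_rational)
    (hMZ : ∀ A : AbelianVariety ℂ, A.dim = 4 ∨ A.dim = 5 →
      ∀ c : complexBetti A.X (2 * 2), IsRationalClass c → IsOfHodgeType A.dim A.X (2 * 2) 2 2 c →
        c ∈ divisorClassesSpan A.X A.dim 2 ⊔
          Submodule.span ℂ {w' : complexBetti A.X (2 * 2) |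
            ∃ (B : AbelianVariety ℂ) (g : A.X ⟶ B.X) (d : ℕ) (φ : B ⟶ B) (w : complexBetti B.X (2 * 2)),
              B.dim = 4 ∧ 0 < d ∧ φ ≫ φ = -(d • 𝟙 B) ∧
              IsRationalClass w ∧ IsOfHodgeType B.dim B.X (2 * 2) 2 2 w ∧
              w ∈ weilClassesOf B φ 2 d ∧ w' = complexBetti.map g (2 * 2) w}) :
    MoonenZarhin1999_hodgeClasses_abelian_dim_le_five_of_weilClassesFourfolds :=
  MoonenZarhin1999_hodgeClasses_abelian_dim_le_five_of_weilClassesFourfolds_of_codim_two_pullback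
    (fun A _ b hb hbb ↦ by
      have hX : IsSmoothProjective A.dim A.X := AbelianVariety.isSmoothProjective_holds
      exact h1 hX b hb hbb)
    hMZ

/-- **The Moonen–Zarhin reduction from the named Kodaira–Serre fact and (MZ)**:
`kodairaSerre_exists_globalSection_algebraicTwist → (MZ) → MoonenZarhin1999_hodgeClasses_abelian_dim_le_five_of_weilClassesFourfolds`
(Lefschetz `(1,1)` from the Kodaira–Serre existence of sections after an algebraic twist,
`lefschetzOneOne_rational_of_kodairaSerre_fact`; Voisin I, proof of Cor. 11.34).
[cite: VoisinHodgeI2002, Cor. 11.34 (proof), Thm. 7.11 and Thm. 11.30]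
[cite: MoonenZarhin1999LowDim, Thm. 0.1 and Thm. 0.2] [cite: Markman2025SurveySecant, §1.1 and proof of Cor. 1.3] -/
theorem MoonenZarhin1999_hodgeClasses_abelian_dim_le_five_of_weilClassesFourfolds_of_kodairaSerre
    (hKS : kodairaSerre_exists_globalSection_algebraicTwist)
    (hMZ : ∀ A : AbelianVariety ℂ, A.dim = 4 ∨ A.dim = 5 →
      ∀ c : complexBetti A.X (2 * 2), IsRationalClass c → IsOfHodgeType A.dim A.X (2 * 2) 2 2 c →
        c ∈ divisorClassesSpan A.X A.dim 2 ⊔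
          Submodule.span ℂ {w' : complexBetti A.X (2 * 2) |
            ∃ (B : AbelianVariety ℂ) (g : A.X ⟶ B.X) (d : ℕ) (φ : B ⟶ B) (w : complexBetti B.X (2 * 2)),
              B.dim = 4 ∧ 0 < d ∧ φ ≫ φ = -(d • 𝟙 B) ∧
              IsRationalClass w ∧ IsOfHodgeType B.dim B.X (2 * 2) 2 2 w ∧
              w ∈ weilClassesOf B φ 2 d ∧ w' = complexBetti.map g (2 * 2) w}) :
    MoonenZarhin1999_hodgeClasses_abelian_dim_le_five_of_weilClassesFourfolds :=
  MoonenZarhin1999_hodgeClasses_abelian_dim_le_five_of_weilClassesFourfolds_of_lefschetzOneOne_pullback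
    (lefschetzOneOne_rational_of_kodairaSerre_fact hKS) hMZ

/-- **The fact from its ONE named leaf and (MZ)**:
`serreGAGA_lineCocycle_iso_cartierDivisorCocycle → (MZ) → MoonenZarhin1999_hodgeClasses_abelian_dim_le_five_of_weilClassesFourfolds`.
GAGA for line bundles (Serre 1956, n° 20 Prop. 18, `r = 1`: every holomorphic line cocycle on `X^an`
is holomorphically isomorphic to some `𝒪_X(D)^an`) is the only unproved named fact of the tree on which
Lefschetz `(1,1)` still rests (`lefschetzOneOne_rational_of_serreGAGA`, file `LefschetzOneOneOfGAGA`);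
hard Lefschetz, cup products with divisor classes and pull-backs to abelian varieties are theorems.
So `theorem …_holds := …_of_serreGAGA serreGAGA_lineCocycle_iso_cartierDivisorCocycle_holds ‹(MZ)›`
the day Serre's Prop. 18 and the codimension-`2` parts of Moonen–Zarhin's Thms. 0.1–0.2 are theorems
of the tree — nothing else is owed. [cite: SerreGAGA1956, n° 20 Prop. 18]
[cite: VoisinHodgeI2002, Thm. 11.30, Cor. 11.34 and Thm. 6.25] [cite: MoonenZarhin1999LowDim, Thm. 0.1 and Thm. 0.2]
[cite: Markman2025SurveySecant, §1.1 and proof of Cor. 1.3] [cite: RamonMari2008, Prop. 2.18] -/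
theorem MoonenZarhin1999_hodgeClasses_abelian_dim_le_five_of_weilClassesFourfolds_of_serreGAGA
    (hG : serreGAGA_lineCocycle_iso_cartierDivisorCocycle)
    (hMZ : ∀ A : AbelianVariety ℂ, A.dim = 4 ∨ A.dim = 5 →
      ∀ c : complexBetti A.X (2 * 2), IsRationalClass c → IsOfHodgeType A.dim A.X (2 * 2) 2 2 c →
        c ∈ divisorClassesSpan A.X A.dim 2 ⊔
          Submodule.span ℂ {w' : complexBetti A.X (2 * 2) |
            ∃ (B : AbelianVariety ℂ) (g : A.X ⟶ B.X) (d : ℕ) (φ : B ⟶ B) (w : complexBetti B.X (2 * 2)),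
              B.dim = 4 ∧ 0 < d ∧ φ ≫ φ = -(d • 𝟙 B) ∧
              IsRationalClass w ∧ IsOfHodgeType B.dim B.X (2 * 2) 2 2 w ∧
              w ∈ weilClassesOf B φ 2 d ∧ w' = complexBetti.map g (2 * 2) w}) :
    MoonenZarhin1999_hodgeClasses_abelian_dim_le_five_of_weilClassesFourfolds :=
  MoonenZarhin1999_hodgeClasses_abelian_dim_le_five_of_weilClassesFourfolds_of_lefschetzOneOne_pullback
    (lefschetzOneOne_rational_of_serreGAGA hG) hMZ

/-- **… and from the named leaf with the two separate inputs (MZ4), (MZ5⁺)** of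
`…_of_lefschetzOneOne'`: `serreGAGA_lineCocycle_iso_cartierDivisorCocycle → (MZ4) → (MZ5⁺) → fact`.
[cite: SerreGAGA1956, n° 20 Prop. 18] [cite: MoonenZarhin1999LowDim, Thm. 0.1 and Thm. 0.2] -/
theorem MoonenZarhin1999_hodgeClasses_abelian_dim_le_five_of_weilClassesFourfolds_of_serreGAGA'
    (hG : serreGAGA_lineCocycle_iso_cartierDivisorCocycle)
    (hMZ4 : ∀ A : AbelianVariety ℂ, A.dim = 4 →
      ∀ c : complexBetti A.X (2 * 2), IsRationalClass c → IsOfHodgeType A.dim A.X (2 * 2) 2 2 c →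
        c ∈ divisorClassesSpan A.X A.dim 2 ⊔
          Submodule.span ℂ {w : complexBetti A.X (2 * 2) | ∃ (d : ℕ) (φ : A ⟶ A), 0 < d ∧
            φ ≫ φ = -(d • 𝟙 A) ∧ IsRationalClass w ∧ IsOfHodgeType A.dim A.X (2 * 2) 2 2 w ∧
            w ∈ weilClassesOf A φ 2 d})
    (hMZ5 : ∀ A : AbelianVariety ℂ, A.dim = 5 →
      ∀ c : complexBetti A.X (2 * 2), IsRationalClass c → IsOfHodgeType A.dim A.X (2 * 2) 2 2 c →
        c ∈ divisorClassesSpan A.X A.dim 2 ⊔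
          Submodule.span ℂ {w' : complexBetti A.X (2 * 2) |
            ∃ (B : AbelianVariety ℂ) (g : A.X ⟶ B.X) (d : ℕ) (φ : B ⟶ B) (w : complexBetti B.X (2 * 2)),
              B.dim = 4 ∧ 0 < d ∧ φ ≫ φ = -(d • 𝟙 B) ∧
              IsRationalClass w ∧ IsOfHodgeType B.dim B.X (2 * 2) 2 2 w ∧
              w ∈ weilClassesOf B φ 2 d ∧ w' = complexBetti.map g (2 * 2) w}) :
    MoonenZarhin1999_hodgeClasses_abelian_dim_le_five_of_weilClassesFourfolds :=
  MoonenZarhin1999_hodgeClasses_abelian_dim_le_five_of_weilClassesFourfolds_of_serreGAGA hG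
    (codim_two_pullback_of_codim_two hMZ4 hMZ5)

/-! ### The PRINTED codimension-`2` generating sets of Thms. 0.1–0.2: (MZ01) on fourfolds, (MZ02) on fivefolds

Two hypothesis shapes that are, literally, the codimension-`2` parts of the two printed theorems,
each self-contained (neither is rewritten through the other):

* (MZ01) = (MZ4) verbatim — Thm. 0.1, codimension `2`: on a complex abelian FOURFOLD `X`, every
  rational `(2,2)`-class lies in `(D² ⊗ ℂ) + span_ℂ {rational (2,2) classes of the Weil planes
  weilClassesOf X φ 2 d, φ ≫ φ = -d, d ≥ 1}` (cases (a), (b): "generated by the subalgebra `D•(X)` of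
  divisor classes together with the space of Weil classes `W_k ⊂ B²(X)`"; case (c): "together with the
  spaces of Weil classes `W_k ⊂ B²(X)`, where `k` runs through the set of imaginary quadratic fields
  contained in `D`"; case (d) and (4): `B•(X) = D•(X)`; every such `k ⊂ End⁰(X)` is `ℚ(φ)` with
  `φ ∈ End(X)`, `φ² = -d`, and `W_k ⊗ ℂ = weilClassesOf X φ 2 d`, module docstring of `WeilClasses`).
* (MZ02) — Thm. 0.2, codimension `2`, in ITS OWN generating set: on a complex abelian FIVEFOLD `X`,
  every rational `(2,2)`-class lies in `(D² ⊗ ℂ) + span_ℂ {α^* w : α : X ⟶ X' a SURJECTIVE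
  homomorphism onto an abelian FOURFOLD X', w a rational (2,2)-class of X'}`: (1) case (e): the
  `W_{k,α}`, images of the Hodge classes `W_k ⊂ B²(X₁ × X₂)` of the abelian fourfold `X₁ × X₂` "under
  the map `B²(X₁ × X₂) → B²(X)` induced by a surjective homomorphism `α : X → X₁ × X₂`"; (2) case (f):
  "the pull-backs of the Weil classes in `W_k ⊂ B²(X₁ × X₂)`"; (3) case (g): `B•(X) = D•(X)`; (4)
  otherwise "`B•(Xⁿ)` is generated by the images of the Hodge rings `B•(Y_j^{m_j})`" of the isotypic
  factors — in codimension `2` these images are products of two pulled-back divisor classes (in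
  `D²(X)`) and, when `X ∼ Y × Y'` has a simple factor `Y` of dimension `4`, the image of `B²(Y)` along
  the projection `X → Y`, a surjective homomorphism onto an abelian fourfold; and "if `X` has no simple
  factor of dimension 4 then … `B•(Xⁿ) = D•(Xⁿ)`" (which covers simple fivefolds: Tankeev–Ribet).

Granted the antecedent of the fact and Lefschetz `(1,1)`, (MZ01) makes every rational `(2,2)`-class of
every abelian fourfold algebraic (`mem_algebraicClasses_two_of_dim_eq_four`), whereupon the generators
`α^* w` of (MZ02) are pull-backs of ALGEBRAIC classes, algebraic on the fivefold by
`map_mem_algebraicClasses_of_abelianVariety` (`mem_algebraicClasses_two_of_dim_eq_five_of_fourfolds`).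
So the pair ((MZ01), (MZ02)) feeds the converse direction of `…_iff_codim_two'` exactly as
((MZ4), (MZ5⁺)) does, WITHOUT first rewriting the Hodge classes of the quotient fourfold `X'` through
its own divisor and Weil classes (which, on the carriers, would need the functoriality of rationality
and of Hodge types under `α^*`): `…_of_codim_two_printed`, `…_of_lefschetzOneOne_printed`,
`…_of_kodairaSerre_printed`, `…_of_serreGAGA_printed` (`serreGAGA… → (MZ01) → (MZ02) → fact`). Among
the fivefold hypotheses of this file (MZ02) has the LARGEST generating set — it contains that of
(MZ5) (`span_pullback_weilClasses_le_span_pullback_hodgeClasses`) — hence is the weakest assumption,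
the one a vendored statement of Thm. 0.2 (codimension-`2` part) should make. -/

/-- **The codimension-`2` step on an abelian fivefold from Thm. 0.2's own generating set.** If every
rational `(2,2)`-class on every complex abelian FOURFOLD is algebraic and Lefschetz `(1,1)` holds on
the abelian variety `A`, then every class of `H⁴(A(ℂ); ℂ)` lying in
`(D² ⊗ ℂ) + span_ℂ {α^* w : B an abelian fourfold, α : A ⟶ B a surjective homomorphism, w a rational (2,2)-class of B}`
is algebraic: `D² ⊗ ℂ ⊆ N² H⁴` (`AbelianVariety.divisorClassesSpan_le_algebraicClasses`), `w ∈ N² H⁴(B)`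
by hypothesis, and pull-back to an abelian variety preserves `N² H⁴`
(`map_mem_algebraicClasses_of_abelianVariety`; the surjectivity of `α`, part of the printed generating
set, is not used by the proof). [cite: MoonenZarhin1999LowDim, Thm. 0.2]
[cite: Fulton1998, §19.2 Cor. 19.2 (b) and Appendix B.9.2 (a)] -/
theorem mem_algebraicClasses_two_of_dim_eq_five_of_fourfolds
    (h4 : ∀ B : AbelianVariety ℂ, B.dim = 4 → ∀ w : complexBetti B.X (2 * 2), IsRationalClass w →
      IsOfHodgeType B.dim B.X (2 * 2) 2 2 w → w ∈ algebraicClasses B.X 2)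
    (A : AbelianVariety ℂ)
    (h11 : ∀ b : complexBetti A.X (2 * 1), IsRationalClass b → IsOfHodgeType A.dim A.X (2 * 1) 1 1 b →
      b ∈ algebraicClasses A.X 1)
    {c : complexBetti A.X (2 * 2)}
    (hc : c ∈ divisorClassesSpan A.X A.dim 2 ⊔
      Submodule.span ℂ {w' : complexBetti A.X (2 * 2) |
        ∃ (B : AbelianVariety ℂ) (α : A ⟶ B) (w : complexBetti B.X (2 * 2)),
          B.dim = 4 ∧ Surjective (AbelianVariety.Hom.toSchemeHom α) ∧
          IsRationalClass w ∧ IsOfHodgeType B.dim B.X (2 * 2) 2 2 w ∧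
          w' = complexBetti.map α.hom.hom.hom (2 * 2) w}) :
    c ∈ algebraicClasses A.X 2 := by
  refine (sup_le (AbelianVariety.divisorClassesSpan_le_algebraicClasses A h11 2)
    (Submodule.span_le.2 ?_)) hc
  rintro w' ⟨B, α, w, hB, -, hw, hw22, rfl⟩
  have hXA : IsSmoothProjective A.dim A.X := AbelianVariety.isSmoothProjective_holds
  exact map_mem_algebraicClasses_of_abelianVariety hXA B α.hom.hom.hom (h4 B hB w hw hw22)

/-- **(MZ02) is the weakest fivefold hypothesis of this file**: the generating set of (MZ5) — the
pull-backs along flat surjective homomorphisms of rational `(2,2)` WEIL classes of abelian fourfolds —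
lies in that of (MZ02) — the pull-backs along surjective homomorphisms of ALL rational `(2,2)`-classes
of abelian fourfolds — so (MZ5) implies (MZ02). [folklore] -/
theorem span_pullback_weilClasses_le_span_pullback_hodgeClasses (A : AbelianVariety ℂ) :
    Submodule.span ℂ {w' : complexBetti A.X (2 * 2) |
        ∃ (B : AbelianVariety ℂ) (α : A ⟶ B) (d : ℕ) (φ : B ⟶ B) (w : complexBetti B.X (2 * 2)),
          B.dim = 4 ∧ Surjective (AbelianVariety.Hom.toSchemeHom α) ∧
          Flat (AbelianVariety.Hom.toSchemeHom α) ∧ 0 < d ∧ φ ≫ φ = -(d • 𝟙 B) ∧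
          IsRationalClass w ∧ IsOfHodgeType B.dim B.X (2 * 2) 2 2 w ∧
          w ∈ weilClassesOf B φ 2 d ∧ w' = complexBetti.map α.hom.hom.hom (2 * 2) w} ≤
      Submodule.span ℂ {w' : complexBetti A.X (2 * 2) |
        ∃ (B : AbelianVariety ℂ) (α : A ⟶ B) (w : complexBetti B.X (2 * 2)),
          B.dim = 4 ∧ Surjective (AbelianVariety.Hom.toSchemeHom α) ∧
          IsRationalClass w ∧ IsOfHodgeType B.dim B.X (2 * 2) 2 2 w ∧
          w' = complexBetti.map α.hom.hom.hom (2 * 2) w} := by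
  refine Submodule.span_mono ?_
  rintro w' ⟨B, α, d, φ, w, hB, hα, -, -, -, hw, hw22, -, rfl⟩
  exact ⟨B, α, w, hB, hα, hw, hw22, rfl⟩

/-- **The Moonen–Zarhin reduction from Lefschetz `(1,1)` on abelian varieties of dimension `≤ 5` and
the PRINTED codimension-`2` generating sets (MZ01), (MZ02)** (hard Lefschetz, cup products with divisor
classes and pull-backs to abelian varieties being theorems of the tree): IF (L11) every rational
`(1,1)`-class on a complex abelian variety of dimension `≤ 5` is algebraic, (MZ01) on every complex
abelian fourfold every rational `(2,2)`-class lies in `(D² ⊗ ℂ) + span_ℂ {rational (2,2) Weil classes}`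
— Moonen–Zarhin, Math. Ann. 315 (1999) Thm. 0.1, codimension-`2` part (simple fourfolds: Moonen–Zarhin
1995; products of abelian surfaces: Ramón Marí 2008 Prop. 2.18) — and (MZ02) on every complex abelian
fivefold every rational `(2,2)`-class lies in `(D² ⊗ ℂ) + span_ℂ {α^* w}` over the surjective
homomorphisms `α` onto abelian fourfolds and their rational `(2,2)`-classes `w` — ibid. Thm. 0.2,
codimension-`2` part (simple fivefolds: Tankeev) — THEN
`MoonenZarhin1999_hodgeClasses_abelian_dim_le_five_of_weilClassesFourfolds`. Proof: the converse
direction of `…_iff_codim_two'`; dimension `4` by `mem_algebraicClasses_two_of_dim_eq_four`, dimension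
`5` by `mem_algebraicClasses_two_of_dim_eq_five_of_fourfolds` fed with the dimension-`4` conclusion.
[cite: MoonenZarhin1999LowDim, Thm. 0.1, Thm. 0.2 and (1.9)] [cite: Markman2025SurveySecant, §1.1 and proof of Cor. 1.3]
[cite: RamonMari2008, Prop. 2.18] [cite: MoonenZarhin1995Duke, main theorem]
[cite: VoisinHodgeI2002, Thm. 6.25 and Thm. 11.30] [cite: Fulton1998, §19.2 Cor. 19.2 (b) and Appendix B.9.2 (a)] -/
theorem MoonenZarhin1999_hodgeClasses_abelian_dim_le_five_of_weilClassesFourfolds_of_codim_two_printed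
    (h1 : ∀ A : AbelianVariety ℂ, A.dim ≤ 5 → ∀ b : complexBetti A.X (2 * 1), IsRationalClass b →
      IsOfHodgeType A.dim A.X (2 * 1) 1 1 b → b ∈ algebraicClasses A.X 1)
    (h01 : ∀ A : AbelianVariety ℂ, A.dim = 4 →
      ∀ c : complexBetti A.X (2 * 2), IsRationalClass c → IsOfHodgeType A.dim A.X (2 * 2) 2 2 c →
        c ∈ divisorClassesSpan A.X A.dim 2 ⊔
          Submodule.span ℂ {w : complexBetti A.X (2 * 2) | ∃ (d : ℕ) (φ : A ⟶ A), 0 < d ∧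
            φ ≫ φ = -(d • 𝟙 A) ∧ IsRationalClass w ∧ IsOfHodgeType A.dim A.X (2 * 2) 2 2 w ∧
            w ∈ weilClassesOf A φ 2 d})
    (h02 : ∀ A : AbelianVariety ℂ, A.dim = 5 →
      ∀ c : complexBetti A.X (2 * 2), IsRationalClass c → IsOfHodgeType A.dim A.X (2 * 2) 2 2 c →
        c ∈ divisorClassesSpan A.X A.dim 2 ⊔
          Submodule.span ℂ {w' : complexBetti A.X (2 * 2) |
            ∃ (B : AbelianVariety ℂ) (α : A ⟶ B) (w : complexBetti B.X (2 * 2)),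
              B.dim = 4 ∧ Surjective (AbelianVariety.Hom.toSchemeHom α) ∧
              IsRationalClass w ∧ IsOfHodgeType B.dim B.X (2 * 2) 2 2 w ∧
              w' = complexBetti.map α.hom.hom.hom (2 * 2) w}) :
    MoonenZarhin1999_hodgeClasses_abelian_dim_le_five_of_weilClassesFourfolds :=
  (MoonenZarhin1999_hodgeClasses_abelian_dim_le_five_of_weilClassesFourfolds_iff_codim_two' h1).2
    fun hW A hA c hc hcc ↦ by
      rcases hA with h4 | h5
      · exact mem_algebraicClasses_two_of_dim_eq_four hW A h4 (h1 A (by omega)) (h01 A h4 c hc hcc)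
      · exact mem_algebraicClasses_two_of_dim_eq_five_of_fourfolds
          (fun B hB w hw hww ↦
            mem_algebraicClasses_two_of_dim_eq_four hW B hB (h1 B (by omega)) (h01 B hB w hw hww))
          A (h1 A (by omega)) (h02 A h5 c hc hcc)

/-- **`lefschetzOneOne_rational → (MZ01) → (MZ02) → MoonenZarhin1999_hodgeClasses_abelian_dim_le_five_of_weilClassesFourfolds`.**
[cite: MoonenZarhin1999LowDim, Thm. 0.1 and Thm. 0.2] [cite: VoisinHodgeI2002, Thm. 6.25 and Thm. 11.30] -/
theorem MoonenZarhin1999_hodgeClasses_abelian_dim_le_five_of_weilClassesFourfolds_of_lefschetzOneOne_printed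
    (h1 : lefschetzOneOne_rational)
    (h01 : ∀ A : AbelianVariety ℂ, A.dim = 4 →
      ∀ c : complexBetti A.X (2 * 2), IsRationalClass c → IsOfHodgeType A.dim A.X (2 * 2) 2 2 c →
        c ∈ divisorClassesSpan A.X A.dim 2 ⊔
          Submodule.span ℂ {w : complexBetti A.X (2 * 2) | ∃ (d : ℕ) (φ : A ⟶ A), 0 < d ∧
            φ ≫ φ = -(d • 𝟙 A) ∧ IsRationalClass w ∧ IsOfHodgeType A.dim A.X (2 * 2) 2 2 w ∧
            w ∈ weilClassesOf A φ 2 d})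
    (h02 : ∀ A : AbelianVariety ℂ, A.dim = 5 →
      ∀ c : complexBetti A.X (2 * 2), IsRationalClass c → IsOfHodgeType A.dim A.X (2 * 2) 2 2 c →
        c ∈ divisorClassesSpan A.X A.dim 2 ⊔
          Submodule.span ℂ {w' : complexBetti A.X (2 * 2) |
            ∃ (B : AbelianVariety ℂ) (α : A ⟶ B) (w : complexBetti B.X (2 * 2)),
              B.dim = 4 ∧ Surjective (AbelianVariety.Hom.toSchemeHom α) ∧
              IsRationalClass w ∧ IsOfHodgeType B.dim B.X (2 * 2) 2 2 w ∧
              w' = complexBetti.map α.hom.hom.hom (2 * 2) w}) :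
    MoonenZarhin1999_hodgeClasses_abelian_dim_le_five_of_weilClassesFourfolds :=
  MoonenZarhin1999_hodgeClasses_abelian_dim_le_five_of_weilClassesFourfolds_of_codim_two_printed
    (fun A _ b hb hbb ↦ by
      have hX : IsSmoothProjective A.dim A.X := AbelianVariety.isSmoothProjective_holds
      exact h1 hX b hb hbb)
    h01 h02

/-- **`kodairaSerre_exists_globalSection_algebraicTwist → (MZ01) → (MZ02) → MoonenZarhin1999_hodgeClasses_abelian_dim_le_five_of_weilClassesFourfolds`**
(Lefschetz `(1,1)` from the Kodaira–Serre existence of sections after an algebraic twist,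
`lefschetzOneOne_rational_of_kodairaSerre_fact`). [cite: VoisinHodgeI2002, Cor. 11.34 (proof), Thm. 7.11 and Thm. 11.30]
[cite: MoonenZarhin1999LowDim, Thm. 0.1 and Thm. 0.2] -/
theorem MoonenZarhin1999_hodgeClasses_abelian_dim_le_five_of_weilClassesFourfolds_of_kodairaSerre_printed
    (hKS : kodairaSerre_exists_globalSection_algebraicTwist)
    (h01 : ∀ A : AbelianVariety ℂ, A.dim = 4 →
      ∀ c : complexBetti A.X (2 * 2), IsRationalClass c → IsOfHodgeType A.dim A.X (2 * 2) 2 2 c →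
        c ∈ divisorClassesSpan A.X A.dim 2 ⊔
          Submodule.span ℂ {w : complexBetti A.X (2 * 2) | ∃ (d : ℕ) (φ : A ⟶ A), 0 < d ∧
            φ ≫ φ = -(d • 𝟙 A) ∧ IsRationalClass w ∧ IsOfHodgeType A.dim A.X (2 * 2) 2 2 w ∧
            w ∈ weilClassesOf A φ 2 d})
    (h02 : ∀ A : AbelianVariety ℂ, A.dim = 5 →
      ∀ c : complexBetti A.X (2 * 2), IsRationalClass c → IsOfHodgeType A.dim A.X (2 * 2) 2 2 c →
        c ∈ divisorClassesSpan A.X A.dim 2 ⊔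
          Submodule.span ℂ {w' : complexBetti A.X (2 * 2) |
            ∃ (B : AbelianVariety ℂ) (α : A ⟶ B) (w : complexBetti B.X (2 * 2)),
              B.dim = 4 ∧ Surjective (AbelianVariety.Hom.toSchemeHom α) ∧
              IsRationalClass w ∧ IsOfHodgeType B.dim B.X (2 * 2) 2 2 w ∧
              w' = complexBetti.map α.hom.hom.hom (2 * 2) w}) :
    MoonenZarhin1999_hodgeClasses_abelian_dim_le_five_of_weilClassesFourfolds :=
  MoonenZarhin1999_hodgeClasses_abelian_dim_le_five_of_weilClassesFourfolds_of_lefschetzOneOne_printed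
    (lefschetzOneOne_rational_of_kodairaSerre_fact hKS) h01 h02

/-- **The fact from its ONE named leaf and the two PRINTED codimension-`2` generation theorems**:
`serreGAGA_lineCocycle_iso_cartierDivisorCocycle → (MZ01) → (MZ02) → MoonenZarhin1999_hodgeClasses_abelian_dim_le_five_of_weilClassesFourfolds`,
where (MZ01) / (MZ02) are, literally, the codimension-`2` parts of Moonen–Zarhin's Thm. 0.1 (abelian
fourfolds: `B² ⊆ D² + Σ_k W_k`) and Thm. 0.2 (abelian fivefolds: `B² ⊆ D² + Σ_α α^* B²(X')` over the
surjective homomorphisms `α` onto abelian fourfolds `X'`), and GAGA for line bundles (Serre 1956, n° 20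
Prop. 18) is the only unproved named fact of the tree beneath Lefschetz `(1,1)`
(`lefschetzOneOne_rational_of_serreGAGA`). This is the shape in which the fact is discharged from
NAMED facts of the tree: `theorem …_holds := …_of_serreGAGA_printed serreGAGA_…_holds ‹Thm. 0.1›_holds ‹Thm. 0.2›_holds`
the day the three are theorems. [cite: SerreGAGA1956, n° 20 Prop. 18]
[cite: MoonenZarhin1999LowDim, Thm. 0.1, Thm. 0.2 and (1.9)] [cite: Markman2025SurveySecant, §1.1 and proof of Cor. 1.3]
[cite: RamonMari2008, Prop. 2.18] [cite: VoisinHodgeI2002, Thm. 11.30, Cor. 11.34 and Thm. 6.25] -/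
theorem MoonenZarhin1999_hodgeClasses_abelian_dim_le_five_of_weilClassesFourfolds_of_serreGAGA_printed
    (hG : serreGAGA_lineCocycle_iso_cartierDivisorCocycle)
    (h01 : ∀ A : AbelianVariety ℂ, A.dim = 4 →
      ∀ c : complexBetti A.X (2 * 2), IsRationalClass c → IsOfHodgeType A.dim A.X (2 * 2) 2 2 c →
        c ∈ divisorClassesSpan A.X A.dim 2 ⊔
          Submodule.span ℂ {w : complexBetti A.X (2 * 2) | ∃ (d : ℕ) (φ : A ⟶ A), 0 < d ∧
            φ ≫ φ = -(d • 𝟙 A) ∧ IsRationalClass w ∧ IsOfHodgeType A.dim A.X (2 * 2) 2 2 w ∧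
            w ∈ weilClassesOf A φ 2 d})
    (h02 : ∀ A : AbelianVariety ℂ, A.dim = 5 →
      ∀ c : complexBetti A.X (2 * 2), IsRationalClass c → IsOfHodgeType A.dim A.X (2 * 2) 2 2 c →
        c ∈ divisorClassesSpan A.X A.dim 2 ⊔
          Submodule.span ℂ {w' : complexBetti A.X (2 * 2) |
            ∃ (B : AbelianVariety ℂ) (α : A ⟶ B) (w : complexBetti B.X (2 * 2)),
              B.dim = 4 ∧ Surjective (AbelianVariety.Hom.toSchemeHom α) ∧
              IsRationalClass w ∧ IsOfHodgeType B.dim B.X (2 * 2) 2 2 w ∧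
              w' = complexBetti.map α.hom.hom.hom (2 * 2) w}) :
    MoonenZarhin1999_hodgeClasses_abelian_dim_le_five_of_weilClassesFourfolds :=
  MoonenZarhin1999_hodgeClasses_abelian_dim_le_five_of_weilClassesFourfolds_of_lefschetzOneOne_printed
    (lefschetzOneOne_rational_of_serreGAGA hG) h01 h02

/-- **The residue of the fact in the tree is exactly Moonen–Zarhin's two printed codimension-`2`
generation theorems**: `(MZ01) → (MZ02) → MoonenZarhin1999_hodgeClasses_abelian_dim_le_five_of_weilClassesFourfolds`,
where (MZ01) is the codimension-`2` part of Thm. 0.1 (abelian fourfolds: `B² ⊆ D² + Σ_k W_k`) and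
(MZ02) that of Thm. 0.2 (abelian fivefolds: `B² ⊆ D² + Σ_α α^* B²(X')` over the surjective
homomorphisms `α` onto abelian fourfolds `X'`). Everything else of Markman's combination (Lefschetz
`(1,1)` — now the theorem `lefschetzOneOne_rational_of_kodairaSerre_fact kodairaSerre_exists_globalSection_algebraicTwist_holds`,
hard Lefschetz `nonempty_hardLefschetzNFold_holds`, dimension `≤ 3`, products and pull-backs of
algebraic classes, the passage from Weil classes of fourfolds to the fivefold) is PROVED:
`…_of_kodairaSerre_printed` applied to the theorem `kodairaSerre_exists_globalSection_algebraicTwist_holds`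
(Serre's dimension count, GAGA n° 16 Lemme 8, file `KodairaSerreSectionsAllDim`).
[cite: MoonenZarhin1999LowDim, Thm. 0.1, Thm. 0.2 and (1.9)] [cite: Markman2025SurveySecant, §1.1 and proof of Cor. 1.3]
[cite: RamonMari2008, Prop. 2.18] [cite: VoisinHodgeI2002, Thm. 11.30, Cor. 11.34 and Thm. 6.25]
[cite: SerreGAGA1956, n° 16 Lemme 8] -/
theorem MoonenZarhin1999_hodgeClasses_abelian_dim_le_five_of_weilClassesFourfolds_of_printed
    (h01 : ∀ A : AbelianVariety ℂ, A.dim = 4 →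
      ∀ c : complexBetti A.X (2 * 2), IsRationalClass c → IsOfHodgeType A.dim A.X (2 * 2) 2 2 c →
        c ∈ divisorClassesSpan A.X A.dim 2 ⊔
          Submodule.span ℂ {w : complexBetti A.X (2 * 2) | ∃ (d : ℕ) (φ : A ⟶ A), 0 < d ∧
            φ ≫ φ = -(d • 𝟙 A) ∧ IsRationalClass w ∧ IsOfHodgeType A.dim A.X (2 * 2) 2 2 w ∧
            w ∈ weilClassesOf A φ 2 d})
    (h02 : ∀ A : AbelianVariety ℂ, A.dim = 5 →
      ∀ c : complexBetti A.X (2 * 2), IsRationalClass c → IsOfHodgeType A.dim A.X (2 * 2) 2 2 c →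
        c ∈ divisorClassesSpan A.X A.dim 2 ⊔
          Submodule.span ℂ {w' : complexBetti A.X (2 * 2) |
            ∃ (B : AbelianVariety ℂ) (α : A ⟶ B) (w : complexBetti B.X (2 * 2)),
              B.dim = 4 ∧ Surjective (AbelianVariety.Hom.toSchemeHom α) ∧
              IsRationalClass w ∧ IsOfHodgeType B.dim B.X (2 * 2) 2 2 w ∧
              w' = complexBetti.map α.hom.hom.hom (2 * 2) w}) :
    MoonenZarhin1999_hodgeClasses_abelian_dim_le_five_of_weilClassesFourfolds :=
  MoonenZarhin1999_hodgeClasses_abelian_dim_le_five_of_weilClassesFourfolds_of_kodairaSerre_printed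
    kodairaSerre_exists_globalSection_algebraicTwist_holds h01 h02

/-- **The merged codimension-`2` hypothesis (MZ) alone now implies the fact**: rational
`(2,2)`-classes on complex abelian varieties of dimension `4` and `5` lie in the span of divisor
monomials and of pull-backs (along arbitrary morphisms) of rational `(2,2)` Weil classes of abelian
fourfolds `⟹` the fact — Lefschetz `(1,1)` being the theorem
`lefschetzOneOne_rational_of_kodairaSerre_fact kodairaSerre_exists_globalSection_algebraicTwist_holds`
and hard Lefschetz `nonempty_hardLefschetzNFold_holds` (`…_of_kodairaSerre` applied to the theorem).
[cite: MoonenZarhin1999LowDim, Thm. 0.1 and Thm. 0.2] [cite: VoisinHodgeI2002, Thm. 11.30, Cor. 11.34 and Thm. 6.25] -/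
theorem MoonenZarhin1999_hodgeClasses_abelian_dim_le_five_of_weilClassesFourfolds_of_codim_two_merged
    (hMZ : ∀ A : AbelianVariety ℂ, A.dim = 4 ∨ A.dim = 5 →
      ∀ c : complexBetti A.X (2 * 2), IsRationalClass c → IsOfHodgeType A.dim A.X (2 * 2) 2 2 c →
        c ∈ divisorClassesSpan A.X A.dim 2 ⊔
          Submodule.span ℂ {w' : complexBetti A.X (2 * 2) |
            ∃ (B : AbelianVariety ℂ) (g : A.X ⟶ B.X) (d : ℕ) (φ : B ⟶ B) (w : complexBetti B.X (2 * 2)),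
              B.dim = 4 ∧ 0 < d ∧ φ ≫ φ = -(d • 𝟙 B) ∧
              IsRationalClass w ∧ IsOfHodgeType B.dim B.X (2 * 2) 2 2 w ∧
              w ∈ weilClassesOf B φ 2 d ∧ w' = complexBetti.map g (2 * 2) w}) :
    MoonenZarhin1999_hodgeClasses_abelian_dim_le_five_of_weilClassesFourfolds :=
  MoonenZarhin1999_hodgeClasses_abelian_dim_le_five_of_weilClassesFourfolds_of_kodairaSerre
    kodairaSerre_exists_globalSection_algebraicTwist_holds hMZ

/-- **The fact from the two NAMED codimension-`2` facts of Moonen–Zarhin 1999.** The binders `h01`,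
`h02` of `…_of_printed` are now the named facts
`MoonenZarhin1999_codimTwoHodgeClasses_abelianFourfold` (Thm. 0.1, codimension `2`, abelian
fourfolds) and `MoonenZarhin1999_codimTwoHodgeClasses_abelianFivefold` (Thm. 0.2, codimension `2`,
abelian fivefolds) of `AbelianLowDimensionCodimTwoHodgeClasses` (vendored verbatim from those
binders), so the fact is EXACTLY their conjunction's consequence: every other input of the printed
combination — GAGA / Kodaira–Serre for line bundles
(`kodairaSerre_exists_globalSection_algebraicTwist_holds`), Lefschetz `(1,1)`, hard Lefschetz,
Poincaré duality, pull-back of algebraic classes, the Hodge conjecture in dimension `≤ 3` — is a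
theorem of the tree. The discharge `…_holds` is this theorem applied to the two `_holds` the day they
are proved. [cite: MoonenZarhin1999LowDim, Thm. 0.1, Thm. 0.2 and (1.9)]
[cite: Markman2025SurveySecant, §1.1 and proof of Cor. 1.3] [cite: RamonMari2008, Prop. 2.18] -/
theorem MoonenZarhin1999_hodgeClasses_abelian_dim_le_five_of_weilClassesFourfolds_of_codimTwoFacts
    (h01 : MoonenZarhin1999_codimTwoHodgeClasses_abelianFourfold)
    (h02 : MoonenZarhin1999_codimTwoHodgeClasses_abelianFivefold) :
    MoonenZarhin1999_hodgeClasses_abelian_dim_le_five_of_weilClassesFourfolds :=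
  MoonenZarhin1999_hodgeClasses_abelian_dim_le_five_of_weilClassesFourfolds_of_printed h01 h02

/-- Pointwise form: the two named facts and Markman's Weil-class theorem on abelian fourfolds give the
algebraicity of every rational Hodge class on complex abelian varieties of dimension `≤ 5`
(Markman's Cor. 1.3 modulo exactly the two Moonen–Zarhin inputs).
[cite: Markman2025SurveySecant, Cor. 1.3] [cite: MoonenZarhin1999LowDim, Thm. 0.1 and Thm. 0.2] -/
theorem Markman2025_hodgeClasses_algebraic_abelian_dim_le_five_of_codimTwoFacts
    (h01 : MoonenZarhin1999_codimTwoHodgeClasses_abelianFourfold)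
    (h02 : MoonenZarhin1999_codimTwoHodgeClasses_abelianFivefold)
    (hW : Markman2025_weilClasses_algebraic_abelianFourfold) :
    Markman2025_hodgeClasses_algebraic_abelian_dim_le_five :=
  MoonenZarhin1999_hodgeClasses_abelian_dim_le_five_of_weilClassesFourfolds_of_codimTwoFacts h01 h02 hW

end HodgeTheory

end Literature.AlgebraicGeometry.HodgeTheory

end
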